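import Summits.PneNP.PneNP.Theses.ConvexRankGates
import Literature.Computability.Complexity.ExtMonotoneCliqueGate
import Literature.Computability.Complexity.ExtMonotoneGRankSupport
import Literature.Computability.Complexity.CircuitLowerBoundsProofs
import Literature.Computability.Complexity.ExtMonotoneCircuits
import Literature.Computability.Complexity.NegationElimination
import Summits.PneNP.PneNP.Theorems.LinAlgGateBlind.Negative.ValiantCertificate
import Summits.PneNP.PneNP.Theorems.CliqueExtLowerBound.Negative.LargeCliquesMonotone
import Summits.PneNP.PneNP.Theorems.ConvexRankGatesConvexGateBlindCertificates
import Summits.PneNP.PneNP.Theorems.ConvexRankGatesConvexGateBlindThresholds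
import Summits.PneNP.PneNP.Theorems.ConvexRankGatesConvexGateBlindMatchingCount

/-!
# Disproof of `CliqueExtLowerBound` — findings (standing disprover, gen 3)

Crux `stmt-PneNP-10682` = `Summit.PneNP.PneNP.Theses.ConvexRankGates.CliqueExtLowerBound`:
`∃ δ ∈ (0,1/2), ∀ c, ∀ᶠ m, no circuit with ≤ m^c gates over B_{m^c} = {∧₂,∨₂} ∪ CONV_{m^c} ∪
PERM_{m^c} ∪ GRANK_{m^c} computes CLIQUE(m, ⌈m^δ⌉₊)`.

VERDICT SO FAR: **not refuted, not mis-stated** (gen 1; gen 2; gen 3 cycle 1 — this file, §10–§13 new).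

Findings, all `sorry`-free unless marked NEAR-MISS:
* §0 `cliqueExtLowerBound_iff` — the inline gate class IS `extGate` and the inline clique function IS
  `cliqueFn` (bridge to the Literature API); schedule form `LowerBoundAt k`.
* §1 REFUTED SCHEDULES (natural strengthenings / degenerate regimes): `not_lowerBoundAt_of_choose_le` —
  whenever `C(m, k m) ≤ m^j` eventually, ONE LP gate (a CONV gate, `CliqueLPGate.cliqueGate_isConvGate`)
  of width ≤ m^{j+3} computes CLIQUE(m, k m), so the lower bound at schedule `k` is FALSE: constant `k`
  (`not_lowerBoundAt_const`, includes the δ = 0 mutation `not_lowerBoundAt_delta_zero`), `k = m - t`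
  (`not_lowerBoundAt_sub_const`), `k = m` (δ = 1, `not_lowerBoundAt_delta_one`). Any proof must use BOTH
  `⌈m^δ⌉₊ → ∞` and `m - ⌈m^δ⌉₊ → ∞`.
* §2 WIDTH bound `p + q ≤ s` is load-bearing: `cliqueExtLowerBound_false_without_width`.
* §3 SIZE bound is load-bearing: `cliqueExtLowerBound_false_without_size` (monotone DNF over {∧₂,∨₂}).
* §4 QUANTIFIER ORDER `∀ c, ∀ᶠ m` is load-bearing: one threshold `m₀` for all `c` is false
  (`cliqueExtLowerBound_false_uniform`).
* §5 `B ≥ 0` is what keeps `¬` out: `not_isConvGate_without_nonneg`, `not_not_mem_extGate`.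
* §6 GRANK obligation: a GRANK gate wired to the edges that computes CLIQUE(m,k), k ≥ 2, must, for EVERY
  k-set T, have a θ-minor monomial whose wires read EXACTLY the edges of T (`grank_sees_every_clique`).
* §7 (NEW, gen 2) PERM universality: every monotone span program over 𝔽₂ — rows indexed by WIRES, so a
  variable may own many rows — is ONE PERM gate on `2·dim` points (`spanGate_isPermGate`: translations of
  `ZMod 2 × κ`), and CLIQUE(m,k) (k ≥ 2) is ONE PERM gate (`exists_onePermGate_computes`): the CYCLE span
  program (one 𝔽₂-cycle through the edges of each k-set, target hung on edge 0; soundness by an explicit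
  killing functional, `tgt_mem_closure_iff`), `permWidth ≤ 2(1 + C(m,k)·#E) ≤ m^{j+3}` once
  `C(m,k) ≤ m^j`. Consequences (§7.4): the PERM dimension bound `d ≤ s` is load-bearing for the crux
  (`cliqueExtLowerBound_false_without_permDim`, fails at c = 0) AND every schedule refutation of §1 holds
  verbatim for crux #4 `LinAlgGateBlind` (`linAlgGateBlind_iff`, `not_linLowerBoundAt_of_choose_le`,
  `_const`, `_sub_const`): PERM_s ⊇ MSP_{𝔽₂} of dimension s/2 − 1 with arbitrary row multiplicity.
* §7.5–7.6 (NEW, gen 2): `abelianProgram_isPermGate` — the same for ANY finite abelian group G (PERM_s ⊇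
  monotone span programs over every prime field 𝔽_p of dimension ≤ s/p, rows owned by wires);
  `msp_dim_lower_bound_of_cliqueExtLowerBound` — SANITY IMPLICATION: the crux ⇒ no 𝔽₂-mSP of dimension
  ≤ m^c/2 computes CLIQUE(m,⌈m^δ⌉₊) eventually (consistent with Pitassi–Robere 2018; a refutation of this
  consequence would refute the crux).
* §8 (NEW, gen 2; requested by card `certificates-on-the-defect`) CONV gates AS TYPED may reject without a
  Farkas certificate: `exists_convData_uncertified_rejection` — data of width 4 realising the IDENTITY gate
  whose rejection at 0 is weakly infeasible (`Y ⪰ 0, Y₀₀ ≤ 0, Y₀₁ + Y₁₀ ≥ 2`); certifiedness is a property of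
  the realisation, so certificate-based arguments must re-realise CONV gates first (LP data: always
  certified by Farkas). The question left OPEN here in gen 2 — does every CONV-realisable function have a
  fully certified realisation of comparable width? — is ANSWERED YES by the crux-#2 provers
  (`Theorems/ConvexRankGatesConvexGateBlindCertificates.lean`: on a finite input type the trace
  normalisation `tr Y ≤ R` is free, `conv_feasible_iff_traceBounded`, and trace-bounded SDPs have Farkas
  certificates, `certificate_of_infeasible_traceBounded`); so "rejection = non-negative certificate" is
  available after normalisation, at width `+1`.
* §9 (NEW, session 2) **A NEW REFUTED REGIME `m − k = Θ(log m)`**: `not_lowerBoundAt_sub_clog (c ≥ 1) :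
  ¬ LowerBoundAt (fun m => m − c·Nat.log 3 m)` — CLIQUE(m, m − c⌊log₃ m⌋) has circuits of size ≤ m^{c+7} over
  B_{m^{c+7}} (indeed over unbounded-fan-in {∧,∨}: `exists_circuit_largeClique`) although
  C(m, c log m) = m^{Θ(log m)} is superpolynomial (so §1's single-gate kills do not apply). Colour-coding +
  2-SAT cuts: `cliqueFn_sub_eq_true_iff_exists_coloring_cut` (CLIQUE(m,m−k) = ⋁_{h∈𝓗} ⋀_u (Cut ∨ Cut) for
  every perfect hash family 𝓗; APT existence half `exists_assignment`), reachability DP as a circuit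
  (`cktSize_family`, O(m⁴) gates per colouring), Mehlhorn–Schmidt counting (`exists_perfect_hash_family`).
  PLAIN MONOTONE VERSION (§9.7): `exists_monotone_circuit_largeClique` — over {∧₂,∨₂} (no constants, fan-in 2),
  ≤ m^{c+7} gates, via ∧/∨ chains + constant elimination (`GateList.const_or_exists_monotone_circuit`).
  Improves Andreev–Jukna 2008 (Jukna 2012 Thm 9.7: poly monotone formulas for m−k = O(√log m); CHOPRS 2022
  HM Frontier E quote the same) to m−k = O(log m) for circuits; the lower-bound side (Jukna 2012 Prop 9.6)
  bites only for m−k = ω(log³ m). Cross-checked by brute force (colorcoding/verify.py, all graphs n ≤ 6).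
* §10 (NEW, gen 3) APEX PADDING OF EXTENDED CIRCUITS: `cliqueFn_extV` (CLIQUE(m, k'+(m−m')) ∘ extV =
  CLIQUE(m', k')), `exists_circuit_extV` (a restriction of a `B_s`-circuit is a `B_s`-circuit, `≤ #E(K_m)` extra
  constant gates — constants are GRANK₀ gates, `constTrue_mem_extGate`), `not_lowerBoundAt_of_padding` /
  `LowerBoundAt.of_padding`: `LowerBoundAt k' → LowerBoundAt k` whenever eventually `k m = k' m' + (m − m')` for
  some `m' ≤ m ≤ m'^2` (exponent `c ↦ 2c+5`).
* §11 (NEW, gen 3) **THE HARD BAND + MONOTONICITY IN δ**: `LowerBoundAt.band` — hardness at `⌈m^δ⌉₊` forces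
  hardness at EVERY schedule with `⌈m^δ⌉₊ ≤ k m ≤ m − Nat.sqrt m − 1` (discrete IVT `exists_sub_ceil_eq` for the
  defect `j − ⌈j^δ⌉₊`); `lowerBoundAt_rpow_mono` (`0 < δ' ≤ δ < 1`), `cliqueExtLowerBound_iff_interval` (the crux
  = `LowerBoundAt ⌈m^δ⌉₊` on a whole interval `[δ₀,1)`, `δ₀ < 1/2` — the route's `δ < 1/2` buys nothing),
  `lowerBoundAt_of_cliqueExtLowerBound` (every `δ ∈ [1/2,1)`), `lowerBoundAt_half_of_cliqueExtLowerBound`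
  (`k = m/2`), `lowerBoundAt_sub_rpow_of_cliqueExtLowerBound` (`k = m − ⌈m^ε⌉₊`, `1/2 < ε < 1`).
  **REFUTATION TARGET WIDENED** (`not_cliqueExtLowerBound_of_not_lowerBoundAt_band`): polynomial `B_{m^c}`-circuits
  infinitely often for `CLIQUE(m, k m)` at ANY ONE schedule with `⌈√m⌉₊ ≤ k m ≤ m − √m − 1` (e.g. `k = ⌈√m⌉₊`,
  `m/2`, `m − ⌈m^{2/3}⌉₊`) kill the crux.
* §12 (NEW, gen 3) GRANK CONSEQUENCES (from the sibling seat's landed `LinAlgGateBlind/Negative/ValiantCertificate`: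
  ONE GRANK gate over ℚ of dimension `1 + C(m,k)·#E` computes CLIQUE(m,k)): `cliqueExtLowerBound_false_without_grankDim`
  — the GRANK dimension bound is load-bearing on its own, so EACH of the three width parameters inside `Ext` is
  used by any proof; `not_gRankLowerBoundAt_of_choose_le` (+ `_const`, `_sub_const`) — the §1 schedule kills hold
  over EACH one-class sub-basis separately; `grank_dim_lower_bound_of_cliqueExtLowerBound` — the crux in
  single-GRANK-gate language (Valiant-hard by the sibling's `dc_cliquePoly_superpolynomial_of_linAlgGateBlind`).
* REGIME MAP for the strengthening "LowerBoundAt k for every schedule" (gen 3): REFUTED — min(k, m−k) = O(1) (§1,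
  one LP / PERM / GRANK gate, §12) and m − k = Θ(log m) (§9, {∧,∨}); FORCED BY THE CRUX — the whole band
  m^{δ₀} ≤ k ≤ m − m^{1/2} (§11; with `m ≤ m'^A` in the padding, down to defect m − k ≥ m^{1/A} for every fixed A);
  believed/known hard — k = m^δ (Alon–Boppana for {∧,∨} up to k ≤ m^{2/3}), m − k = ω(log³ m) for {∧,∨};
  OPEN here — log m ≪ m−k ≪ log³ m for {∧,∨}. ON PAPER (not Lean): under non-uniform ETH no polynomial
  circuits with P/poly-evaluable gates exist for ANY defect schedule m − k = k'(m) with ω(log m) ≤ k' ≤ log³ m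
  (CLIQUE(M, M−t) on H̄ joined with M−n universal vertices = [H has a vertex cover of size t]; choosing M with
  k'(M) = t, e.g. M = 2^{√t} for k' = log² m, turns a poly(M)-size family into 2^{o(n)}-size circuits for
  VERTEX COVER on n-vertex graphs), so §9's Θ(log m) boundary is tight for tame gates modulo ETH (for k' = C·log m
  the same padding costs 2^{Θ(t/C)}, no contradiction); polylog defects pad only to EXPONENTIALLY larger
  instances, which is why §9 and §11 do not collide.
* §13 (NEW, gen 3; prose at the end of this docblock) TARGETS for the picked line
  `width-threshold-certificate-sparsity`: what a counterexample to `stub_algebraicReplaceable` must be.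
* §14 (NEW, gen 3) **THE CONV DOOR NEEDS MANY ROWS** (unconditional corner, any psd dimension, any real data):
  `pow_le_of_convEdgeData` — CONV data with `p` rows separating k-cliques from (k−1)-colourings force
  `(k−1)^m ≤ (#E·C(m,k)+1)^p · k² m^{k²} (k−1)^{(m+k)/2+k²}` (strict Farkas certificates after the free trace
  normalisation; heavy sets = sign patterns of #E·C(m,k) linear functionals on ℝ^p, `card_signPatterns_le`:
  ≤ (N+1)^p regions; per heavy set the provers' matching count); `not_computes_cliqueFn_of_convFewRows`,
  `cliqueExtLowerBound_convFewRows_corner` — at δ = 1/4, eventually, no one-gate circuit over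
  {∧₂,∨₂} ∪ CONV^{rows ≤ P} with `16P(k+3) + 18k² + k + 16 < m` (P ≈ m^{3/4}/16) computes CLIQUE(m, ⌈m^{1/4}⌉₊).
  With the crux-#2 provers' corners (LP variables q ≳ m/(64(c+2)); psd block q ≳ m^{3/8}): a single-gate CONV
  kill needs BOTH ≳ m^{3/4} rows AND a psd block ≳ m^{3/8}; the "wild reals with O(1) constraints" loophole is
  closed.
* LITERATURE (session 2): Hrubeš, ECCC TR19-034 §3.4 (Thm 20, Open Problem 3): the single-LP-gate case of the
  crux is literally "find an explicit monotone f with superpolynomial monotone separation complexity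
  sep₊(f)", characterised as the strict non-negative rank min_ε rk₊(M₊(f) − εJ) ± (2n+1) of the defect matrix
  M₊(f)[y,x] = |x ∖ y| (rejecting y, accepting x) — for CLIQUE on the referee pair this is the intersection
  matrix |E ∩ E(K)| of card certificates-on-the-defect.
* DONE ELSEWHERE (siblings, cite — do not redo): GRANK universality (`LinAlgGateBlind/Negative/CliquePolyDetRepr`,
  `ValiantCertificate`: CLIQUE is one GRANK gate, dim 1 + C(m,k)#E; PERM connectivity gadget `OnePermGate`);
  CONV-circuit COLLAPSE to one CONV gate and δ-monotonicity for the CONV basis (`Cruxes/ConvexGateBlind/Disproof.lean`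
  §C, §E); gate LOCALITY of PERM/GRANK and fixed-width refutations of Capture (`Capture/Negative/GateLocality`,
  `FixedWidth`).
* NOT here (next regimes): a Lean proof that ONE CONV gate with q = 0 (an AND of non-negative thresholds) needs
  ≥ (k−1)^m / m^{4C(k,2)+2k} constraints for CLIQUE(m,k) (paper proof in §13: heavy edges of a threshold form a
  k-clique transversal A; a killed Turán graph has complement within 2C(k,2) edges of A), i.e. the auxiliary
  dimension q — not the constraint count p — carries all the CONV difficulty; the abelian-PERM counting
  threshold of §13 as a theorem; ICL-falsifier hunting for `event-sandwich-interpolation`.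

WHY IT RESISTS (numbers, not adjectives):
* every tame gate (PERM: Sims/FHL membership in P; GRANK over ℚ/𝔽_q with poly bit-size: Schwartz–Zippel;
  CONV with q = 0: thresholds) is P/poly-evaluable, so a tame poly-size kill gives NP ⊆ P/poly;
* CONV single gate of width m^c = an exact psd-lift of width m^c of SOME convex up-set sandwiched between
  the k-clique indicators and the k-clique-free graphs — open even for LP lifts (Oliveira–Pudlák 2019, p. 3,
  Thm 6.10); exact SDP feasibility is not known to be in P (Ramana 1997), so this kill would NOT contradict
  NP ⊄ P/poly, but no construction is known; theta/SOS levels accept the dense negatives (Coja-Oghlan 2005,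
  Jones et al. 2022) — that is blindness OF A METHOD, not a gate for CLIQUE;
* GRANK single gate = a d × d affine symbolic matrix, d ≤ m^c, over SOME field, all of whose θ-minor
  monomial supports contain a k-clique and cover every k-clique (§6): a monotone-support cousin of the
  determinantal complexity of clique-supported polynomials (VNP-complete family, Bürgisser 2000); the
  field may be wild (any `F : Type`), which is the only place the statement exceeds NP ⊄ P/poly.
* The only refutable regimes are min(k, m-k) = O(1) (§1, §12) and m − k = Θ(log m) (§9), plus the
  dropped-hypothesis mutations (§2–§5, §7.4, §12); by §11 a kill anywhere in the band √m ≤ k ≤ m − √m would do,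
  and none is in sight: for TAME gates every point of the band is an NP-complete clique family (NP ⊄ P/poly
  morally forbids it), for WILD gates (exact SDP with real data, GRANK over huge fields) no construction exists.

§13 TARGETS (picked line `width-threshold-certificate-sparsity`, lead prover-line-stmt-PneNP-10682; its drefute
seat already filed stub-false for `stub_convReplaceable` via the anchored theta gate). On paper, for the lead:
* `stub_inline`, `stub_narrowAlgebraic`, `stub_referee` re-derived here and found SOUND as filed (per-gate errors
  (s−1)^r (k/m)^{v(r)}, v(r) ≥ √(2(r−1)), on the positive side and (r−1)^s m^{−(s−1)/8} resp. L^s m^{−(s−1)/8},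
  L ≤ (r−1)·log₂(T!) = m^{1/16+o(1)}, on the negative side: for `stub_inline` (3/4)√(2(r₀−1)) > a + c + 1 and
  s₀ > 8(a + c + 1) + 1 suffice, for `stub_narrowAlgebraic` (3/4)√(2(r₀−1)) > c + 1 and s₀ > 16c + 18; the
  switching costs are independent of fan-in and of #terms, so unbounded n and ≤ m^{c+3} distinct child pairs are
  harmless; minimal generating sets of a PERM_T gate ARE strict subgroup chains, length ≤ log₂ T!).
* `stub_algebraicReplaceable` (the open residue): a counterexample must be TWO-SIDED (Ψ ≡ 0 / Ψ ≡ 1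
  discharge every gate accepting ≤ ε of the positives or rejecting ≤ ε of the negatives, ε = 1/(8m^{c+1})), and
  with raw-edge children (r = s = 2, D_j = C_j = {{e_j}}) a poly-width PERM/GRANK gate φ on the edges IS one as
  soon as Pr_pos[φ] > 1/2 + ε and Pr_neg[¬φ] > ε + η, η = the negative-side error forced on any size-m^a
  monotone {∧,∨}-circuit accepting half the bare cliques (superpolynomially small on this pair by Alon–Boppana /
  the line's own engine) — i.e. a monotone planted-clique DETECTOR for bare ⌈m^{1/4}⌉-cliques against K_m minus
  a uniform (#E/⌊m^{1/8}⌋)-set. COUNTING says where NOT to look: a detector accepting ≥ 1/2 of the bare k-cliques has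
  all its maxterms of size ≥ C(m,2)/(2C(k,2)) ≈ m^{3/2}, each contained in the random missing set with
  probability ≤ m^{−m^{3/2}/16}, so it needs ≥ m^{m^{3/2}/16 − c − 2} maxterms: an ABELIAN PERM gate (span
  program over 𝔽_p of dimension D, §7.5; maxterms = supports of functionals, ≤ p^D of them) needs
  D·log p ≥ m^{3/2 − o(1)}, i.e. PERM width ≥ m^{3/2−o(1)} — no abelian counterexample at c = 1; nonabelian PERM
  (≤ 2^{d²/16} subgroups of Sym d) is not excluded by counting for d ≥ m^{3/4+o(1)}, GRANK never. For TAME gates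
  a detector is a P/poly planted-clique detector far below the spectral threshold √(m/p) (conjectured
  impossible); for WILD GRANK it is an unknown algebraic construction. Verdict: no cheap kill of
  `stub_algebraicReplaceable`; its truth is an AVERAGE-CASE single-gate lower bound (open, like the sibling's
  `stub_sgPerm`/`stub_sgGRank` for crux #4's line).
-/

set_option linter.dupNamespace false

namespace Summit.PneNP.PneNP.Cruxes.CliqueExtLowerBound.Disproof

open Literature.Computability.Complexity Literature.Computability.Complexity.CliqueLPGate Filter Finset
open Summit.PneNP.PneNP.Theses.ConvexRankGates (CliqueExtLowerBound)

/-! ## §0 Bridge: the inline gate class is `extGate`, the inline clique function is `cliqueFn` -/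

/-- The gate class inlined (as a `let`) in the crux, copied verbatim. [folklore] -/
def inlineExt : ℕ → Set GateFn := fun s => {g | g = Literature.Computability.Complexity.GateFn.and 2 ∨ g = Literature.Computability.Complexity.GateFn.or 2 ∨ (∃ (p q : ℕ), p + q ≤ s ∧ ∃ (A : Fin p → Matrix (Fin q) (Fin q) ℝ) (b : Fin p → ℝ) (B : Fin p → Fin g.1 → ℝ), (∀ i j, 0 ≤ B i j) ∧ ∀ v : Fin g.1 → Bool, g.2 v = true ↔ ∃ Y : Matrix (Fin q) (Fin q) ℝ, Y.PosSemidef ∧ ∀ i, (A i * Y).trace ≤ b i + ∑ j, B i j * (if v j then (1 : ℝ) else 0)) ∨ (∃ d : ℕ, d ≤ s ∧ ∃ (σ : Fin g.1 → Equiv.Perm (Fin d)) (τ : Equiv.Perm (Fin d)), ∀ v : Fin g.1 → Bool, g.2 v = true ↔ τ ∈ Subgroup.closure (σ '' {i | v i = true})) ∨ (∃ (F : Type) (_ : Field F) (d θ : ℕ), d ≤ s ∧ ∃ (K₀ : Matrix (Fin d) (Fin d) F) (K : Fin g.1 → Matrix (Fin d) (Fin d) F), ∀ v : Fin g.1 →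 Bool, g.2 v = true ↔ θ ≤ (K₀.map (algebraMap F (FractionRing (MvPolynomial (Fin g.1) F))) + ∑ i, if v i then (algebraMap (MvPolynomial (Fin g.1) F) (FractionRing (MvPolynomial (Fin g.1) F)) (MvPolynomial.X i)) • (K i).map (algebraMap F (FractionRing (MvPolynomial (Fin g.1) F))) else 0).rank)}

/-- The inline class is the Literature's extended monotone basis `extGate s`. [folklore] -/
theorem inlineExt_eq_extGate (s : ℕ) : inlineExt s = extGate s := by
  ext g
  rw [mem_extGate_iff]
  exact Iff.rfl

/-- Lower bound at an arbitrary clique-size schedule `k : ℕ → ℕ` (the crux is `∃ δ, LowerBoundAt ⌈m^δ⌉₊`).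
[folklore] -/
def LowerBoundAt (k : ℕ → ℕ) : Prop :=
  ∀ c : ℕ, ∀ᶠ m : ℕ in atTop, ∀ C : Circuit ((⊤ : SimpleGraph (Fin m)).edgeSet),
    C.IsOver (extGate (m ^ c)) → C.size ≤ m ^ c → ¬ C.Computes (cliqueFn m (k m))

open Classical in
/-- Read-back of the crux through the Literature API (gate class = `extGate`, function = `cliqueFn`).
[folklore] -/
theorem cliqueExtLowerBound_iff :
    CliqueExtLowerBound ↔ ∃ δ : ℝ, 0 < δ ∧ δ < 1 / 2 ∧ LowerBoundAt (fun m => ⌈(m : ℝ) ^ δ⌉₊) := by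
  have key : ∀ s : ℕ, inlineExt s = extGate s := inlineExt_eq_extGate
  show (∃ δ : ℝ, 0 < δ ∧ δ < 1 / 2 ∧ ∀ c : ℕ, ∀ᶠ m : ℕ in atTop,
      ∀ C : Circuit ((⊤ : SimpleGraph (Fin m)).edgeSet), C.IsOver (inlineExt (m ^ c)) →
        C.size ≤ m ^ c → ¬ C.Computes (cliqueFn m ⌈(m : ℝ) ^ δ⌉₊)) ↔ _
  simp only [key]
  rfl

/-! ## §1 Refuted schedules: `C(m, k m) ≤ m^j` eventually ⇒ the lower bound at `k` is FALSE -/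

/-- **One LP gate kills every polynomially-enumerable schedule.** If `C(m, k m) ≤ m^j` for all large `m`,
then `LowerBoundAt k` fails: at `c = j + 3` the size-1 circuit whose gate is the LP/CONV gate of
`CliqueLPGate.cliqueGate_isConvGate` (width `≤ m^{j+3}`) computes `CLIQUE(m, k m)`. [folklore] -/
theorem not_lowerBoundAt_of_choose_le {k : ℕ → ℕ} {j : ℕ}
    (h : ∀ᶠ m : ℕ in atTop, m.choose (k m) ≤ m ^ j) : ¬ LowerBoundAt k := by
  intro hLB
  obtain ⟨m, hm, hch, h3⟩ := ((hLB (j + 3)).and (h.and (eventually_ge_atTop 3))).exists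
  obtain ⟨C, hC, hs, hc⟩ :=
    exists_oneGate_extGate_computes m (k m) (lpWidth_le_of_choose_le m (k m) j h3 hch)
  exact hm C hC (hs.trans (Nat.one_le_pow _ _ (by omega))) hc

/-- Constant clique size: `LowerBoundAt (fun _ => k)` is false for EVERY `k` (brute force is one LP gate of
width `≤ m^{k+3}`). [folklore] -/
theorem not_lowerBoundAt_const (k : ℕ) : ¬ LowerBoundAt fun _ => k :=
  not_lowerBoundAt_of_choose_le (j := k) (Eventually.of_forall fun m => Nat.choose_le_pow m k)

/-- Co-constant clique size `k = m - t`: false for EVERY `t` (`C(m, m-t) = C(m, t) ≤ m^t`). [folklore] -/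
theorem not_lowerBoundAt_sub_const (t : ℕ) : ¬ LowerBoundAt fun m => m - t := by
  refine not_lowerBoundAt_of_choose_le (j := t) ?_
  filter_upwards [eventually_ge_atTop t] with m hm
  rw [Nat.choose_symm hm]
  exact Nat.choose_le_pow m t

/-- The δ = 0 MUTATION is false: `⌈m^0⌉₊ = 1`, and CLIQUE(m,1) is one gate. So `0 < δ` is load-bearing.
[folklore] -/
theorem not_lowerBoundAt_delta_zero : ¬ LowerBoundAt fun m => ⌈(m : ℝ) ^ (0 : ℝ)⌉₊ := by
  have : (fun m : ℕ => ⌈(m : ℝ) ^ (0 : ℝ)⌉₊) = fun _ => 1 := by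
    funext m; simp
  rw [this]
  exact not_lowerBoundAt_const 1

/-- The δ = 1 endpoint is false: `⌈m^1⌉₊ = m` and CLIQUE(m,m) = ∧ of all edges is one gate. So the natural
strengthening "for every δ ∈ (0,1]" of the crux is FALSE; `m - ⌈m^δ⌉₊ → ∞` is used by any proof. [folklore] -/
theorem not_lowerBoundAt_delta_one : ¬ LowerBoundAt fun m => ⌈(m : ℝ) ^ (1 : ℝ)⌉₊ := by
  have : (fun m : ℕ => ⌈(m : ℝ) ^ (1 : ℝ)⌉₊) = fun m => m - 0 := by
    funext m; simp
  rw [this]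
  exact not_lowerBoundAt_sub_const 0

/-! ## §2 The width bound `p + q ≤ s` (and `d ≤ s`) is load-bearing -/

/-- The crux with the CONV width bound dropped (CONV gates of ANY width allowed; everything else as filed).
[folklore] -/
def CliqueExtLowerBoundWithoutWidth : Prop :=
  ∃ δ : ℝ, 0 < δ ∧ δ < 1 / 2 ∧ ∀ c : ℕ, ∀ᶠ m : ℕ in atTop,
    ∀ C : Circuit ((⊤ : SimpleGraph (Fin m)).edgeSet),
      C.IsOver ({GateFn.and 2, GateFn.or 2} ∪
        {g | (∃ w, IsConvGate w g) ∨ IsPermGate (m ^ c) g ∨ IsGRankGate (m ^ c) g}) →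
      C.size ≤ m ^ c → ¬ C.Computes (cliqueFn m ⌈(m : ℝ) ^ δ⌉₊)

/-- **Any proof must use the width bound**: without `p + q ≤ s` the statement is false already at `c = 0`
(one CONV gate of width `C(m,k)·#E + 1 + C(m,k)` computes CLIQUE(m,k) for every m, k). [folklore] -/
theorem cliqueExtLowerBound_false_without_width : ¬ CliqueExtLowerBoundWithoutWidth := by
  rintro ⟨δ, -, -, h⟩
  obtain ⟨m, hm, h1⟩ := ((h 0).and (eventually_ge_atTop 1)).exists
  obtain ⟨C, hC, hs, hc⟩ := exists_oneConvGate_computes m ⌈(m : ℝ) ^ δ⌉₊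
  refine hm C (hC.mono fun g hg => Or.inr (Or.inl ⟨_, hg⟩)) ?_ hc
  simpa using hs

/-! ## §3 The size bound is load-bearing -/

/-- `2 ≤ ⌈m^δ⌉₊` once `m ≥ 2` and `δ > 0`. [folklore] -/
theorem two_le_ceil_rpow {δ : ℝ} (hδ : 0 < δ) {m : ℕ} (hm : 2 ≤ m) : 2 ≤ ⌈(m : ℝ) ^ δ⌉₊ := by
  have h1 : (1 : ℝ) < (m : ℝ) ^ δ := Real.one_lt_rpow (by exact_mod_cast hm) hδ
  have : 1 < ⌈(m : ℝ) ^ δ⌉₊ := Nat.lt_ceil.2 (by exact_mod_cast h1)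
  omega

/-- `⌈m^δ⌉₊ ≤ m` once `m ≥ 1` and `δ ≤ 1`. [folklore] -/
theorem ceil_rpow_le {δ : ℝ} (hδ : δ ≤ 1) {m : ℕ} (hm : 1 ≤ m) : ⌈(m : ℝ) ^ δ⌉₊ ≤ m := by
  refine Nat.ceil_le.2 ?_
  calc (m : ℝ) ^ δ ≤ (m : ℝ) ^ (1 : ℝ) :=
        Real.rpow_le_rpow_of_exponent_le (by exact_mod_cast hm) hδ
    _ = m := Real.rpow_one _

/-- The crux with the size bound `C.size ≤ m^c` dropped. [folklore] -/
def CliqueExtLowerBoundWithoutSize : Prop :=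
  ∃ δ : ℝ, 0 < δ ∧ δ < 1 / 2 ∧ ∀ c : ℕ, ∀ᶠ m : ℕ in atTop,
    ∀ C : Circuit ((⊤ : SimpleGraph (Fin m)).edgeSet),
      C.IsOver (extGate (m ^ c)) → ¬ C.Computes (cliqueFn m ⌈(m : ℝ) ^ δ⌉₊)

/-- **Any proof must use the size bound**: CLIQUE(m,k) for `2 ≤ k ≤ m` is computed by its monotone DNF over
`{∧₂, ∨₂} ⊆ B_s` (`exists_monotone_computes_cliqueFn_holds`). [folklore] -/
theorem cliqueExtLowerBound_false_without_size : ¬ CliqueExtLowerBoundWithoutSize := by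
  rintro ⟨δ, hδ0, hδ1, h⟩
  obtain ⟨m, hm, h2⟩ := ((h 0).and (eventually_ge_atTop 2)).exists
  obtain ⟨C, hC, hc⟩ := exists_monotone_computes_cliqueFn_holds
    (two_le_ceil_rpow hδ0 h2) (ceil_rpow_le (by linarith) (by omega))
  exact hm C (hC.mono (monotoneBasis_subset_extGate _)) hc

/-! ## §4 The quantifier order `∀ c, ∀ᶠ m` is load-bearing -/

/-- The crux with ONE threshold `m₀` serving every exponent `c` (`∃ m₀, ∀ c, ∀ m ≥ m₀` instead of
`∀ c, ∀ᶠ m`). [folklore] -/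
def CliqueExtLowerBoundUniform : Prop :=
  ∃ δ : ℝ, 0 < δ ∧ δ < 1 / 2 ∧ ∃ m₀ : ℕ, ∀ c : ℕ, ∀ m ≥ m₀,
    ∀ C : Circuit ((⊤ : SimpleGraph (Fin m)).edgeSet),
      C.IsOver (extGate (m ^ c)) → C.size ≤ m ^ c → ¬ C.Computes (cliqueFn m ⌈(m : ℝ) ^ δ⌉₊)

/-- **The uniform version is false**: at `m = max m₀ 3`, `k = ⌈m^δ⌉₊`, the exponent `c = k + 3` admits the
LP gate (`lpWidth m k ≤ m^{k+3}`). [folklore] -/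
theorem cliqueExtLowerBound_false_uniform : ¬ CliqueExtLowerBoundUniform := by
  rintro ⟨δ, -, -, m₀, h⟩
  set m := max m₀ 3 with hm
  have h3 : 3 ≤ m := le_max_right _ _
  obtain ⟨C, hC, hs, hc⟩ := exists_oneGate_extGate_computes m ⌈(m : ℝ) ^ δ⌉₊
    (lpWidth_le m ⌈(m : ℝ) ^ δ⌉₊ h3)
  exact h (⌈(m : ℝ) ^ δ⌉₊ + 3) m (le_max_left _ _) C hC
    (hs.trans (Nat.one_le_pow _ _ (by omega))) hc

/-! ## §5 `B ≥ 0` is exactly what keeps negation out of the basis -/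

/-- CONV gates with the sign condition on `B` dropped. [folklore] -/
def IsConvGate' (s : ℕ) (g : GateFn) : Prop :=
  ∃ p q : ℕ, p + q ≤ s ∧ ∃ (A : Fin p → Matrix (Fin q) (Fin q) ℝ) (b : Fin p → ℝ)
    (B : Fin p → Fin g.1 → ℝ), ∀ v : Fin g.1 → Bool, g.2 v = true ↔
      ∃ Y : Matrix (Fin q) (Fin q) ℝ, Y.PosSemidef ∧
        ∀ i, (A i * Y).trace ≤ b i + ∑ j, B i j * (if v j then (1 : ℝ) else 0)

/-- Without `B ≥ 0`, `¬` is a width-1 "CONV" gate (`p = 1, q = 0, b = 0, B = -1`), so the mutated basis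
contains the De Morgan basis and the mutated crux is a GENERAL circuit lower bound for CLIQUE. [folklore] -/
theorem not_isConvGate' : IsConvGate' 1 GateFn.not := by
  refine ⟨1, 0, le_rfl, fun _ => 0, fun _ => 0, fun _ _ => -1, fun v => ?_⟩
  show (!(v (0 : Fin 1))) = true ↔ ∃ Y : Matrix (Fin 0) (Fin 0) ℝ, Y.PosSemidef ∧
    ∀ i : Fin 1, ((0 : Matrix (Fin 0) (Fin 0) ℝ) * Y).trace ≤
      (0 : ℝ) + ∑ j : Fin 1, (-1 : ℝ) * (if v j then (1 : ℝ) else 0)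
  simp only [Matrix.zero_mul, Matrix.trace_zero, Fin.sum_univ_one, zero_add, Fin.forall_fin_one]
  constructor
  · intro hv
    refine ⟨0, Matrix.PosSemidef.zero, ?_⟩
    have : v (0 : Fin 1) = false := by simpa using hv
    simp [this]
  · rintro ⟨Y, -, h0⟩
    cases hv : v (0 : Fin 1)
    · rfl
    · rw [hv] at h0
      norm_num at h0

/-- …whereas `¬ ∉ B_s` for every `s` (every extended gate is monotone). [folklore] -/
theorem not_not_mem_extGate (s : ℕ) : GateFn.not ∉ extGate s := by
  intro h
  have hmono := extGate_monotone h
  have hle : (fun _ : Fin 1 => false) ≤ (fun _ : Fin 1 => true) := fun _ => Bool.false_le _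
  have := hmono hle
  revert this
  decide

/-! ## §6 The GRANK obligation: one GRANK gate for CLIQUE must see every clique as an exact support -/

section GRank

variable {m : ℕ}

/-- Two `k`-sets, `k ≥ 2`, whose induced edge sets are nested are equal. [folklore] -/
theorem eq_of_edges_subset {k : ℕ} (hk : 2 ≤ k) {T T' : Finset (Fin m)} (hT : T.card = k)
    (hT' : T'.card = k)
    (h : ∀ e : (⊤ : SimpleGraph (Fin m)).edgeSet, (∀ y ∈ (e : Sym2 (Fin m)), y ∈ T') →
      ∀ y ∈ (e : Sym2 (Fin m)), y ∈ T) : T' = T := by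
  refine Finset.eq_of_subset_of_card_le (fun v hv => ?_) (by rw [hT, hT'])
  obtain ⟨w, hw, hwv⟩ : ∃ w ∈ T', w ≠ v := by
    by_contra hno
    push Not at hno
    have : T' ⊆ {v} := fun w hw => Finset.mem_singleton.2 (hno w hw)
    have := Finset.card_le_card this
    rw [hT', Finset.card_singleton] at this
    omega
  have he : s(v, w) ∈ (⊤ : SimpleGraph (Fin m)).edgeSet := by
    rw [SimpleGraph.mem_edgeSet]; exact hwv.symm
  refine h ⟨s(v, w), he⟩ (fun y hy => ?_) v (Sym2.mem_mk_left v w)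
  rcases Sym2.mem_iff.1 hy with rfl | rfl
  · exact hv
  · exact hw

/-- **GRANK obligation.** If ONE GRANK gate `(F, d, θ, K₀, K)`, wired to the edge variables by `w`,
computes CLIQUE(m,k) with `k ≥ 2`, then for EVERY `k`-set `T` some `θ × θ` minor of the generic symbolic
matrix `K₀ + ∑ Xᵢ Kᵢ` has a monomial whose wires read EXACTLY the edges inside `T` — all `C(m,k)` clique
supports must survive cancellation inside one `d × d` affine symbolic matrix. (By
`le_rank_symbolicMatrix_iff`: the gate accepts `x` iff some minor monomial has all its wires on.)
[folklore] -/
theorem grank_sees_every_clique {k n d θ : ℕ} (hk : 2 ≤ k) {F : Type*} [Field F]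
    (K₀ : Matrix (Fin d) (Fin d) F) (K : Fin n → Matrix (Fin d) (Fin d) F)
    (w : Fin n → (⊤ : SimpleGraph (Fin m)).edgeSet)
    (hcomp : ∀ x : (⊤ : SimpleGraph (Fin m)).edgeSet → Bool,
      cliqueFn m k x = true ↔ θ ≤ (symbolicMatrix K₀ K fun i => x (w i)).rank)
    (T : Finset (Fin m)) (hT : T.card = k) :
    ∃ (r c : Fin θ → Fin d), ∃ s ∈ (((symbolicPolyMatrix K₀ K).submatrix r c).det).support,
      ∀ e : (⊤ : SimpleGraph (Fin m)).edgeSet,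
        (∃ i ∈ s.support, w i = e) ↔ ∀ y ∈ (e : Sym2 (Fin m)), y ∈ T := by
  classical
  -- the clique vector of `T` is accepted, through some minor monomial `s`
  set x : (⊤ : SimpleGraph (Fin m)).edgeSet → Bool := fun e => decide (∀ y ∈ (e : Sym2 (Fin m)), y ∈ T)
  have hx : cliqueFn m k x = true :=
    (CliqueLPGate.cliqueFn_eq_true_iff_exists k x).2 ⟨T, hT, fun e he => by simpa [x] using he⟩
  obtain ⟨r, c, s, hs, hon⟩ := (le_rank_symbolicMatrix_iff K₀ K _ θ).1 ((hcomp x).1 hx)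
  refine ⟨r, c, s, hs, fun e => ⟨?_, fun he => ?_⟩⟩
  · rintro ⟨i, hi, rfl⟩
    have := hon i hi
    simpa [x] using this
  · -- the sub-vector supported on the wires of `s` is accepted too, hence contains a k-clique `T' = T`
    set x' : (⊤ : SimpleGraph (Fin m)).edgeSet → Bool := fun e => decide (∃ i ∈ s.support, w i = e)
    have hx' : cliqueFn m k x' = true :=
      (hcomp x').2 ((le_rank_symbolicMatrix_iff K₀ K _ θ).2 ⟨r, c, s, hs, fun i hi => by
        simp only [x', decide_eq_true_eq]; exact ⟨i, hi, rfl⟩⟩)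
    obtain ⟨T', hT', hin⟩ := (CliqueLPGate.cliqueFn_eq_true_iff_exists k x').1 hx'
    have hsub : ∀ e : (⊤ : SimpleGraph (Fin m)).edgeSet, (∀ y ∈ (e : Sym2 (Fin m)), y ∈ T') →
        ∀ y ∈ (e : Sym2 (Fin m)), y ∈ T := by
      intro e' he'
      have h1 := hin e' he'
      simp only [x', decide_eq_true_eq] at h1
      obtain ⟨i, hi, rfl⟩ := h1
      have := hon i hi
      simpa [x] using this
    have hTT : T' = T := eq_of_edges_subset hk hT hT' hsub
    subst hTT
    have h1 := hin e he
    simpa [x'] using h1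

end GRank

/-! ## §7 PERM universality: 𝔽₂ span programs are ONE PERM gate; CLIQUE(m,k) is ONE PERM gate -/

/-! ### 7.1 Translations of `ZMod 2 × κ` realise `(κ → ZMod 2, +)` inside `Sym(2·#κ)` -/

section Flip

variable {κ : Type*}

/-- Translation by `w` in the first coordinate: `(c, p) ↦ (c + w p, p)`. [folklore] -/
def flipAux (w : κ → ZMod 2) : Equiv.Perm (ZMod 2 × κ) where
  toFun p := (p.1 + w p.2, p.2)
  invFun p := (p.1 - w p.2, p.2)
  left_inv p := by simp
  right_inv p := by simp

@[simp] theorem flipAux_apply (w : κ → ZMod 2) (p : ZMod 2 × κ) :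
    flipAux w p = (p.1 + w p.2, p.2) := rfl

theorem flipAux_add (w w' : κ → ZMod 2) : flipAux (w + w') = flipAux w * flipAux w' := by
  ext p : 1
  simp only [Equiv.Perm.mul_apply, flipAux_apply, Pi.add_apply, Prod.mk.injEq, and_true]
  ring

/-- `w ↦ flipAux w` as a monoid hom out of `Multiplicative (κ → ZMod 2)`. [folklore] -/
def flipHomAux : Multiplicative (κ → ZMod 2) →* Equiv.Perm (ZMod 2 × κ) where
  toFun w := flipAux (Multiplicative.toAdd w)
  map_one' := by ext p : 1; simp
  map_mul' a b := by
    show flipAux (Multiplicative.toAdd (a * b)) = _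
    rw [toAdd_mul, flipAux_add]

theorem flipHomAux_injective : Function.Injective (flipHomAux (κ := κ)) := by
  intro a b h
  have key : ∀ p, Multiplicative.toAdd a p = Multiplicative.toAdd b p := fun p => by
    have := congrArg (fun σ : Equiv.Perm (ZMod 2 × κ) => (σ (0, p)).1) h
    simpa [flipHomAux] using this
  exact Multiplicative.toAdd.injective (funext key)

variable [Fintype κ]

/-- The same, transported to permutations of `Fin (#(ZMod 2 × κ))` (the PERM gate format). [folklore] -/
noncomputable def flipHom : Multiplicative (κ → ZMod 2) →* Equiv.Perm (Fin (Fintype.card (ZMod 2 × κ))) :=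
  (Equiv.permCongrHom (Fintype.equivFin (ZMod 2 × κ))).toMonoidHom.comp flipHomAux

theorem flipHom_injective : Function.Injective (flipHom (κ := κ)) :=
  (Equiv.permCongrHom (Fintype.equivFin (ZMod 2 × κ))).injective.comp flipHomAux_injective

/-- **Every 𝔽₂ span program whose rows are owned by wires is ONE PERM gate on `2·dim` points.** Rows
`ρ i ∈ 𝔽₂^κ` (one per WIRE `i` — in a circuit several wires may read the same variable, so a variable may
own many rows, exactly as in Karchmer–Wigderson span programs), target `t`; the gate accepts `v` iff `t`
lies in the span (= subgroup generated, over 𝔽₂) of the rows of the wires that are on. It is the PERM gate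
with `σ i =` translation by `ρ i` and `τ =` translation by `t` on the point set `ZMod 2 × κ`. [folklore] -/
theorem spanGate_isPermGate {n : ℕ} (ρ : Fin n → κ → ZMod 2) (t : κ → ZMod 2)
    (f : (Fin n → Bool) → Bool)
    (hf : ∀ v, f v = true ↔ Multiplicative.ofAdd t ∈
      Subgroup.closure ((fun i => Multiplicative.ofAdd (ρ i)) '' {i | v i = true})) :
    IsPermGate (Fintype.card (ZMod 2 × κ)) ⟨n, f⟩ := by
  refine ⟨_, le_rfl, fun i => flipHom (Multiplicative.ofAdd (ρ i)), flipHom (Multiplicative.ofAdd t),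
    fun v => ?_⟩
  show f v = true ↔ _
  rw [hf v]
  have himg : (fun i : Fin n => flipHom (Multiplicative.ofAdd (ρ i))) '' {i | v i = true} =
      flipHom '' ((fun i => Multiplicative.ofAdd (ρ i)) '' {i | v i = true}) :=
    (Set.image_image _ _ _).symm
  rw [himg, ← MonoidHom.map_closure, Subgroup.mem_map_iff_mem flipHom_injective]

/-- Width bookkeeping: `#(ZMod 2 × κ) = 2·#κ`. [folklore] -/
theorem card_zmod_two_prod : Fintype.card (ZMod 2 × κ) = 2 * Fintype.card κ := by
  rw [Fintype.card_prod, ZMod.card]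

end Flip

/-! ### 7.2 The cycle span program for CLIQUE(m, k) -/

section CliqueSpan

variable (m k : ℕ)

/-- Edges of `K_m` inside the `k`-set `T`. [folklore] -/
abbrev ET (T : KSub m k) : Type := {e : (⊤ : SimpleGraph (Fin m)).edgeSet // ∀ y ∈ (e : Sym2 (Fin m)), y ∈ T.1}

/-- Their number (`= C(k,2)`; only `≤ #E` is used). [folklore] -/
noncomputable def L (T : KSub m k) : ℕ := Fintype.card (ET m k T)

/-- An enumeration of the edges inside `T`. [folklore] -/
noncomputable def enumET (T : KSub m k) : ET m k T ≃ Fin (L m k T) := Fintype.equivFin _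

/-- Wires of the span program: (a `k`-set, the index of one of its edges). [folklore] -/
abbrev W : Type := Σ T : KSub m k, Fin (L m k T)

/-- The edge variable read by a wire. [folklore] -/
noncomputable def wedge (w : W m k) : (⊤ : SimpleGraph (Fin m)).edgeSet := ((enumET m k w.1).symm w.2).1

variable {m k}

/-- Cyclic successor on `Fin n`. [folklore] -/
def nxt {n : ℕ} (j : Fin n) : Fin n := ⟨(j.1 + 1) % n, Nat.mod_lt _ j.pos⟩

theorem val_finRotate {n : ℕ} (j : Fin n) : ((finRotate n j : Fin n) : ℕ) = (j.1 + 1) % n := by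
  cases n with
  | zero => exact j.elim0
  | succ n =>
    rw [coe_finRotate]
    split_ifs with h
    · subst h; simp
    · have : (j : ℕ) < n := Fin.val_lt_last h
      rw [Nat.mod_eq_of_lt (by omega)]

theorem nxt_eq_finRotate {n : ℕ} (j : Fin n) : nxt j = finRotate n j :=
  Fin.ext (by rw [val_finRotate]; rfl)

variable (m k)

/-- Rows: wire `(T, j)` owns `e_{(T,j)} + e_{(T, j+1 mod L)} + [j = 0]·e_⋆` in `𝔽₂^{⋆ ⊔ W}` — the incidence
vectors of ONE cycle through the edges of `T`, with the target coordinate `⋆` hung on the edge of index 0.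
[folklore] -/
noncomputable def row (w : W m k) : Option (W m k) → ZMod 2 :=
  Pi.single (some w) 1 + Pi.single (some ⟨w.1, nxt w.2⟩) 1 +
    if (w.2 : ℕ) = 0 then Pi.single none 1 else 0

/-- Target: `e_⋆`. [folklore] -/
noncomputable def tgt : Option (W m k) → ZMod 2 := Pi.single none 1

variable {m k}

/-- The wires of `T` are all on when every edge inside `T` is on. [folklore] -/
theorem wedge_on_of_forall {x : (⊤ : SimpleGraph (Fin m)).edgeSet → Bool} {T : KSub m k}
    (hT : ∀ e : ET m k T, x e.1 = true) (j : Fin (L m k T)) : x (wedge m k ⟨T, j⟩) = true :=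
  hT _

/-- COMPLETENESS of the cycle program: the rows of one `k`-set sum to the target. [folklore] -/
theorem sum_row_eq_tgt (T : KSub m k) (hL : 0 < L m k T) :
    ∑ j : Fin (L m k T), row m k ⟨T, j⟩ = tgt m k := by
  have h1 : ∑ j : Fin (L m k T), (Pi.single (some (⟨T, nxt j⟩ : W m k)) (1 : ZMod 2) :
      Option (W m k) → ZMod 2) =
      ∑ j : Fin (L m k T), Pi.single (some (⟨T, j⟩ : W m k)) 1 := by
    simp only [nxt_eq_finRotate]
    exact Equiv.sum_comp (finRotate (L m k T))
      (fun j => (Pi.single (some (⟨T, j⟩ : W m k)) (1 : ZMod 2) : Option (W m k) → ZMod 2))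
  have h2 : ∑ j : Fin (L m k T), (if ((j : ℕ) = 0) then (Pi.single none (1 : ZMod 2) :
      Option (W m k) → ZMod 2) else 0) = tgt m k := by
    rw [Finset.sum_ite, Finset.sum_const_zero, add_zero, Finset.sum_const]
    have : (univ.filter fun j : Fin (L m k T) => (j : ℕ) = 0) = {⟨0, hL⟩} := by
      ext j
      simp only [Finset.mem_filter, Finset.mem_univ, true_and, Finset.mem_singleton, Fin.ext_iff]
    rw [this, Finset.card_singleton, one_smul]
    rfl
  simp only [row, Finset.sum_add_distrib, h1, h2]
  have h3 : ∀ f : Option (W m k) → ZMod 2, f + f = 0 := fun f =>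
    funext fun a => CharTwo.add_self_eq_zero (f a)
  rw [h3, zero_add]

/-- The killing functional: `φ_c(f) = f ⋆ + ∑_w c_w f_w`. [folklore] -/
noncomputable def phi (c : W m k → ZMod 2) : (Option (W m k) → ZMod 2) →+ ZMod 2 where
  toFun f := f none + ∑ w, c w * f (some w)
  map_zero' := by simp
  map_add' f g := by
    simp only [Pi.add_apply, mul_add, Finset.sum_add_distrib]
    ring

theorem phi_single_none (c : W m k → ZMod 2) : phi c (Pi.single none 1) = 1 := by
  simp [phi]

theorem phi_single_some (c : W m k → ZMod 2) (w : W m k) : phi c (Pi.single (some w) 1) = c w := by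
  classical
  simp only [phi, AddMonoidHom.coe_mk, ZeroHom.coe_mk]
  rw [Pi.single_eq_of_ne (Option.some_ne_none w).symm, zero_add]
  rw [Finset.sum_eq_single w]
  · simp
  · intro w' _ hne
    rw [Pi.single_eq_of_ne (fun h => hne (Option.some_injective _ h)), mul_zero]
  · intro h; exact absurd (Finset.mem_univ w) h

theorem phi_row (c : W m k → ZMod 2) (T : KSub m k) (j : Fin (L m k T)) :
    phi c (row m k ⟨T, j⟩) = c ⟨T, j⟩ + c ⟨T, nxt j⟩ + if (j : ℕ) = 0 then 1 else 0 := by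
  simp only [row, map_add, phi_single_some]
  split_ifs
  · rw [phi_single_none]
  · rw [map_zero]

/-- SOUNDNESS arithmetic: with `c_{(T,i)} = [1 ≤ i ≤ j_T]`, every row of `T` other than `j_T` is killed.
[folklore] -/
theorem kill_arith {Lt : ℕ} (j jT : Fin Lt) (hne : j ≠ jT) :
    ((if 1 ≤ (j : ℕ) ∧ (j : ℕ) ≤ jT then (1 : ZMod 2) else 0) +
      (if 1 ≤ ((nxt j : Fin Lt) : ℕ) ∧ ((nxt j : Fin Lt) : ℕ) ≤ jT then (1 : ZMod 2) else 0) +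
      if (j : ℕ) = 0 then (1 : ZMod 2) else 0) = 0 := by
  have hj := j.2
  have hjT := jT.2
  have hne' : (j : ℕ) ≠ jT := fun h => hne (Fin.ext h)
  have hmod : ((j : ℕ) + 1 = Lt ∧ ((nxt j : Fin Lt) : ℕ) = 0) ∨
      ((j : ℕ) + 1 < Lt ∧ ((nxt j : Fin Lt) : ℕ) = j + 1) := by
    show ((j : ℕ) + 1 = Lt ∧ ((j : ℕ) + 1) % Lt = 0) ∨ ((j : ℕ) + 1 < Lt ∧ ((j : ℕ) + 1) % Lt = j + 1)
    rcases Nat.lt_or_ge ((j : ℕ) + 1) Lt with h | h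
    · exact Or.inr ⟨h, Nat.mod_eq_of_lt h⟩
    · left
      have : (j : ℕ) + 1 = Lt := by omega
      exact ⟨this, by rw [this, Nat.mod_self]⟩
  generalize ((nxt j : Fin Lt) : ℕ) = r at hmod
  have h11 : (1 : ZMod 2) + 1 = 0 := by decide
  split_ifs <;> simp only [add_zero, zero_add, h11] <;> (exfalso; omega)

/-- **The cycle span program computes CLIQUE** (`k ≥ 2`): the target is generated by the rows of the
on-wires iff some `k`-set has all its edges on. [folklore] -/
theorem tgt_mem_closure_iff (hk : 2 ≤ k) (x : (⊤ : SimpleGraph (Fin m)).edgeSet → Bool) :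
    Multiplicative.ofAdd (tgt m k) ∈ Subgroup.closure
        ((fun w => Multiplicative.ofAdd (row m k w)) '' {w : W m k | x (wedge m k w) = true}) ↔
      ∃ T : KSub m k, ∀ e : ET m k T, x e.1 = true := by
  classical
  -- every k-set, k ≥ 2, has an edge inside it
  have hLpos : ∀ T : KSub m k, 0 < L m k T := by
    intro T
    obtain ⟨a, ha, b, hb, hab⟩ := Finset.one_lt_card.1 (by rw [T.2]; omega)
    have he : s(a, b) ∈ (⊤ : SimpleGraph (Fin m)).edgeSet := by
      rw [SimpleGraph.mem_edgeSet]; exact hab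
    refine Fintype.card_pos_iff.2 ⟨⟨⟨s(a, b), he⟩, fun y hy => ?_⟩⟩
    rcases Sym2.mem_iff.1 hy with rfl | rfl
    · exact ha
    · exact hb
  constructor
  · -- soundness: if every T has an off wire j_T, the functional φ_c kills all on-rows but not the target
    intro hmem
    by_contra hno
    push Not at hno
    have hoff : ∀ T : KSub m k, ∃ j : Fin (L m k T), x (wedge m k ⟨T, j⟩) = false := by
      intro T
      obtain ⟨e, he⟩ := hno T
      refine ⟨enumET m k T e, ?_⟩
      simpa [wedge] using he
    choose jT hjT using hoff
    let c : W m k → ZMod 2 := fun w => if 1 ≤ (w.2 : ℕ) ∧ (w.2 : ℕ) ≤ jT w.1 then 1 else 0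
    have hker : Subgroup.closure
        ((fun w => Multiplicative.ofAdd (row m k w)) '' {w : W m k | x (wedge m k w) = true}) ≤
        (AddMonoidHom.toMultiplicative (phi c)).ker := by
      rw [Subgroup.closure_le]
      rintro _ ⟨⟨T, j⟩, hw, rfl⟩
      rw [SetLike.mem_coe, MonoidHom.mem_ker]
      show Multiplicative.ofAdd (phi c (row m k ⟨T, j⟩)) = 1
      have hne : j ≠ jT T := by
        rintro rfl
        rw [Set.mem_setOf_eq, hjT T] at hw
        exact Bool.false_ne_true hw
      rw [phi_row]
      show Multiplicative.ofAdd (_ : ZMod 2) = Multiplicative.ofAdd 0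
      congr 1
      exact kill_arith j (jT T) hne
    have h1 := hker hmem
    rw [MonoidHom.mem_ker] at h1
    have h2 : phi c (tgt m k) = 0 := by
      have : Multiplicative.ofAdd (phi c (tgt m k)) = Multiplicative.ofAdd (0 : ZMod 2) := h1
      exact Multiplicative.ofAdd.injective this
    rw [tgt, phi_single_none] at h2
    exact one_ne_zero h2
  · -- completeness: the rows of a full k-set sum to the target
    rintro ⟨T, hT⟩
    rw [← sum_row_eq_tgt T (hLpos T), ofAdd_sum]
    refine Subgroup.prod_mem _ fun j _ => Subgroup.subset_closure ⟨⟨T, j⟩, ?_, rfl⟩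
    exact hT _

/-! ### 7.3 CLIQUE(m,k) is ONE PERM gate -/

variable (m k)

/-- Number of wires. [folklore] -/
noncomputable def nW : ℕ := Fintype.card (W m k)

/-- Enumeration of the wires. [folklore] -/
noncomputable def eW : W m k ≃ Fin (nW m k) := Fintype.equivFin _

/-- The PERM width of the construction: `2 · (1 + #wires)`. [folklore] -/
noncomputable def permWidth : ℕ := Fintype.card (ZMod 2 × Option (W m k))

/-- The clique span gate as a gate function of arity `#wires`. [folklore] -/
noncomputable def cliqueSpanGate : GateFn :=
  ⟨nW m k, fun v => @decide (Multiplicative.ofAdd (tgt m k) ∈ Subgroup.closure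
    ((fun i => Multiplicative.ofAdd (row m k ((eW m k).symm i))) '' {i | v i = true}))
      (Classical.dec _)⟩

/-- Its acceptance condition. [folklore] -/
theorem cliqueSpanGate_apply (v : Fin (nW m k) → Bool) :
    (cliqueSpanGate m k).2 v = true ↔ Multiplicative.ofAdd (tgt m k) ∈ Subgroup.closure
      ((fun i => Multiplicative.ofAdd (row m k ((eW m k).symm i))) '' {i | v i = true}) :=
  @decide_eq_true_iff _ (Classical.dec _)

/-- It is a PERM gate on `permWidth m k` points. [folklore] -/
theorem cliqueSpanGate_isPermGate : IsPermGate (permWidth m k) (cliqueSpanGate m k) :=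
  spanGate_isPermGate (fun i => row m k ((eW m k).symm i)) (tgt m k) _ (cliqueSpanGate_apply m k)

/-- **CLIQUE(m,k), k ≥ 2, is computed by a size-1 circuit whose gate is a PERM gate on `permWidth m k`
points** (wire `i` reads the edge `wedge (eW⁻¹ i)`). [folklore] -/
theorem exists_onePermGate_computes (hk : 2 ≤ k) :
    ∃ C : Circuit ((⊤ : SimpleGraph (Fin m)).edgeSet),
      C.IsOver {g | IsPermGate (permWidth m k) g} ∧ C.size ≤ 1 ∧ C.Computes (cliqueFn m k) := by
  classical
  obtain ⟨C, hC, hs, he⟩ := (CktSize.gate (B := {g | IsPermGate (permWidth m k) g})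
    (cliqueSpanGate m k) (cliqueSpanGate_isPermGate m k) (fun i => wedge m k ((eW m k).symm i))).toCircuit
  refine ⟨C, hC, hs, fun x => ?_⟩
  rw [he x, Bool.eq_iff_iff]
  show ((cliqueSpanGate m k).2 fun a => x (wedge m k ((eW m k).symm a))) = true ↔
    cliqueFn m k x = true
  have hset : (fun i => Multiplicative.ofAdd (row m k ((eW m k).symm i))) ''
      {i | x (wedge m k ((eW m k).symm i)) = true} =
      (fun w => Multiplicative.ofAdd (row m k w)) '' {w : W m k | x (wedge m k w) = true} := by
    ext g
    constructor
    · rintro ⟨i, hi, rfl⟩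
      exact ⟨(eW m k).symm i, hi, rfl⟩
    · rintro ⟨w, hw, rfl⟩
      exact ⟨eW m k w, by simpa using hw, by simp⟩
  rw [cliqueSpanGate_apply, hset, tgt_mem_closure_iff hk, CliqueLPGate.cliqueFn_eq_true_iff_exists]
  constructor
  · rintro ⟨T, hT⟩
    exact ⟨T.1, T.2, fun e he => hT ⟨e, he⟩⟩
  · rintro ⟨S, hS, hall⟩
    exact ⟨⟨S, hS⟩, fun e => hall e.1 e.2⟩

/-- Width bookkeeping: `permWidth m k = 2 · (1 + #wires)` and `#wires ≤ C(m,k) · #E`. [folklore] -/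
theorem permWidth_le : permWidth m k ≤ 2 * (1 + m.choose k * nE m) := by
  rw [permWidth, card_zmod_two_prod, Fintype.card_option]
  refine Nat.mul_le_mul_left 2 ?_
  rw [add_comm]
  refine Nat.add_le_add_left ?_ 1
  calc Fintype.card (W m k) = ∑ T : KSub m k, Fintype.card (Fin (L m k T)) := Fintype.card_sigma
    _ = ∑ T : KSub m k, L m k T := by simp only [Fintype.card_fin]
    _ ≤ ∑ _T : KSub m k, nE m := Finset.sum_le_sum fun T _ =>
        Fintype.card_le_of_injective (fun e : ET m k T => e.1) Subtype.val_injective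
    _ = m.choose k * nE m := by rw [Finset.sum_const, Finset.card_univ, smul_eq_mul, ← nK, nK_eq]

/-- `permWidth m k ≤ m^{j+3}` once `C(m,k) ≤ m^j` and `m ≥ 3`. [folklore] -/
theorem permWidth_le_of_choose_le (j : ℕ) (hm : 3 ≤ m) (hq : m.choose k ≤ m ^ j) :
    permWidth m k ≤ m ^ (j + 3) := by
  have h1 : 1 ≤ m := by omega
  refine (permWidth_le m k).trans ?_
  have hn : nE m ≤ m ^ 2 := nE_le m
  have hmul : m.choose k * nE m ≤ m ^ (j + 2) := by
    calc m.choose k * nE m ≤ m ^ j * m ^ 2 := Nat.mul_le_mul hq hn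
      _ = m ^ (j + 2) := by ring
  have htwo : 2 ≤ m ^ (j + 2) := le_trans (by omega) (Nat.le_self_pow (by omega) m)
  calc 2 * (1 + m.choose k * nE m) ≤ 3 * m ^ (j + 2) := by omega
    _ ≤ m * m ^ (j + 2) := Nat.mul_le_mul_right _ hm
    _ = m ^ (j + 3) := by ring

/-- As a `B_s`-circuit for `s ≥ permWidth m k`. [folklore] -/
theorem exists_onePermGate_extGate_computes (hk : 2 ≤ k) {s : ℕ} (hs : permWidth m k ≤ s) :
    ∃ C : Circuit ((⊤ : SimpleGraph (Fin m)).edgeSet),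
      C.IsOver ({GateFn.and 2, GateFn.or 2} ∪ {g | IsPermGate s g}) ∧ C.size ≤ 1 ∧
        C.Computes (cliqueFn m k) := by
  obtain ⟨C, hC, h1, hc⟩ := exists_onePermGate_computes m k hk
  exact ⟨C, hC.mono fun g hg => Or.inr (IsPermGate.mono hg hs), h1, hc⟩

end CliqueSpan


/-! ### 7.4 Consequences: the PERM dimension bound is load-bearing (for the crux AND for `LinAlgGateBlind`) -/

section PermConsequences

/-- Lower bound at schedule `k` over the LINEAR-ALGEBRA sub-basis `{∧₂, ∨₂} ∪ PERM_{m^c} ∪ GRANK_{m^c}` (the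
basis of the route's crux #4 `LinAlgGateBlind`, stmt-PneNP-10681). [folklore] -/
def LinLowerBoundAt (k : ℕ → ℕ) : Prop :=
  ∀ c : ℕ, ∀ᶠ m : ℕ in atTop, ∀ C : Circuit ((⊤ : SimpleGraph (Fin m)).edgeSet),
    C.IsOver ({GateFn.and 2, GateFn.or 2} ∪ {g | IsPermGate (m ^ c) g ∨ IsGRankGate (m ^ c) g}) →
      C.size ≤ m ^ c → ¬ C.Computes (cliqueFn m (k m))

open Classical in
/-- Read-back of crux #4 `LinAlgGateBlind` in schedule form. [folklore] -/
theorem linAlgGateBlind_iff : Summit.PneNP.PneNP.Theses.ConvexRankGates.LinAlgGateBlind ↔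
    ∃ δ : ℝ, 0 < δ ∧ δ < 1 / 2 ∧ LinLowerBoundAt (fun m => ⌈(m : ℝ) ^ δ⌉₊) :=
  Iff.rfl

/-- The full basis contains the linear-algebra sub-basis, so `LowerBoundAt k → LinLowerBoundAt k`.
[folklore] -/
theorem linLowerBoundAt_of_lowerBoundAt {k : ℕ → ℕ} (h : LowerBoundAt k) : LinLowerBoundAt k := by
  intro c
  filter_upwards [h c] with m hm C hC hs
  refine hm C (hC.mono ?_) hs
  rintro g (hg | hg)
  · exact monotoneBasis_subset_extGate _ hg
  · rcases hg with hg | hg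
    · exact hg.mem_extGate
    · exact hg.mem_extGate

/-- **One PERM gate kills every polynomially-enumerable schedule over the linear-algebra sub-basis**:
if `C(m, k m) ≤ m^j` and `k m ≥ 2` eventually, then `LinLowerBoundAt k` is false (so the schedule
refutations of §1 hold for crux #4 `LinAlgGateBlind` verbatim, with PERM in place of the LP gate).
[folklore] -/
theorem not_linLowerBoundAt_of_choose_le {k : ℕ → ℕ} {j : ℕ} (h2 : ∀ᶠ m : ℕ in atTop, 2 ≤ k m)
    (h : ∀ᶠ m : ℕ in atTop, m.choose (k m) ≤ m ^ j) : ¬ LinLowerBoundAt k := by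
  intro hLB
  obtain ⟨m, hm, hk, hch, h3⟩ := ((hLB (j + 3)).and (h2.and (h.and (eventually_ge_atTop 3)))).exists
  obtain ⟨C, hC, hs, hc⟩ := exists_onePermGate_extGate_computes m (k m) hk
    (permWidth_le_of_choose_le m (k m) j h3 hch)
  refine hm C (hC.mono ?_) (hs.trans (Nat.one_le_pow _ _ (by omega))) hc
  rintro g (hg | hg)
  · exact Or.inl hg
  · exact Or.inr (Or.inl hg)

/-- Constant `k ≥ 2` over the linear-algebra sub-basis: false. [folklore] -/
theorem not_linLowerBoundAt_const {k : ℕ} (hk : 2 ≤ k) : ¬ LinLowerBoundAt fun _ => k :=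
  not_linLowerBoundAt_of_choose_le (j := k) (Eventually.of_forall fun _ => hk)
    (Eventually.of_forall fun m => Nat.choose_le_pow m k)

/-- `k = m - t` over the linear-algebra sub-basis: false. [folklore] -/
theorem not_linLowerBoundAt_sub_const (t : ℕ) : ¬ LinLowerBoundAt fun m => m - t := by
  refine not_linLowerBoundAt_of_choose_le (j := t) ?_ ?_
  · filter_upwards [eventually_ge_atTop (t + 2)] with m hm
    omega
  · filter_upwards [eventually_ge_atTop t] with m hm
    rw [Nat.choose_symm hm]
    exact Nat.choose_le_pow m t

/-- The crux with the PERM dimension bound `d ≤ s` dropped (PERM gates on ANY number of points allowed;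
everything else as filed). [folklore] -/
def CliqueExtLowerBoundWithoutPermDim : Prop :=
  ∃ δ : ℝ, 0 < δ ∧ δ < 1 / 2 ∧ ∀ c : ℕ, ∀ᶠ m : ℕ in atTop,
    ∀ C : Circuit ((⊤ : SimpleGraph (Fin m)).edgeSet),
      C.IsOver ({GateFn.and 2, GateFn.or 2} ∪
        {g | IsConvGate (m ^ c) g ∨ (∃ w, IsPermGate w g) ∨ IsGRankGate (m ^ c) g}) →
      C.size ≤ m ^ c → ¬ C.Computes (cliqueFn m ⌈(m : ℝ) ^ δ⌉₊)

/-- **Any proof must use the PERM dimension bound** (not only the CONV width bound of §2): without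
`d ≤ s` the statement is false already at `c = 0` — ONE PERM gate (the 𝔽₂ cycle span program on
`2(1 + #wires)` points) computes CLIQUE(m, ⌈m^δ⌉₊). [folklore] -/
theorem cliqueExtLowerBound_false_without_permDim : ¬ CliqueExtLowerBoundWithoutPermDim := by
  rintro ⟨δ, hδ0, -, h⟩
  obtain ⟨m, hm, h2⟩ := ((h 0).and (eventually_ge_atTop 2)).exists
  obtain ⟨C, hC, hs, hc⟩ := exists_onePermGate_computes m ⌈(m : ℝ) ^ δ⌉₊ (two_le_ceil_rpow hδ0 h2)
  refine hm C (hC.mono fun g hg => Or.inr (Or.inr (Or.inl ⟨_, hg⟩))) ?_ hc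
  simpa using hs

end PermConsequences

/-! ### 7.5 Finite abelian group programs (span programs over every 𝔽_p) are PERM gates -/

section Abelian

variable {G : Type*} [AddCommGroup G] {κ : Type*}

/-- Translation by `w` in the first coordinate of `G × κ`. [folklore] -/
def flipAuxG (w : κ → G) : Equiv.Perm (G × κ) where
  toFun p := (p.1 + w p.2, p.2)
  invFun p := (p.1 - w p.2, p.2)
  left_inv p := by simp
  right_inv p := by simp

/-- `flipAuxG` on points. [folklore] -/
@[simp] theorem flipAuxG_apply (w : κ → G) (p : G × κ) : flipAuxG w p = (p.1 + w p.2, p.2) := rfl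

/-- `w ↦ flipAuxG w` as a monoid hom out of `Multiplicative (κ → G)`. [folklore] -/
def flipHomAuxG : Multiplicative (κ → G) →* Equiv.Perm (G × κ) where
  toFun w := flipAuxG (Multiplicative.toAdd w)
  map_one' := by ext p : 1; simp
  map_mul' a b := by
    show flipAuxG (Multiplicative.toAdd (a * b)) = _
    rw [toAdd_mul]
    ext p : 1
    simp only [Equiv.Perm.mul_apply, flipAuxG_apply, Pi.add_apply, Prod.mk.injEq, and_true]
    abel

/-- `flipHomAuxG` is injective. [folklore] -/
theorem flipHomAuxG_injective : Function.Injective (flipHomAuxG (G := G) (κ := κ)) := by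
  intro a b h
  have key : ∀ p, Multiplicative.toAdd a p = Multiplicative.toAdd b p := fun p => by
    have := congrArg (fun σ : Equiv.Perm (G × κ) => (σ (0, p)).1) h
    simpa [flipHomAuxG] using this
  exact Multiplicative.toAdd.injective (funext key)

variable [Fintype G] [Fintype κ]

/-- The same, transported to `Fin (|G|·|κ|)` (the PERM gate format). [folklore] -/
noncomputable def flipHomG : Multiplicative (κ → G) →* Equiv.Perm (Fin (Fintype.card (G × κ))) :=
  (Equiv.permCongrHom (Fintype.equivFin (G × κ))).toMonoidHom.comp flipHomAuxG

/-- `flipHomG` is injective. [folklore] -/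
theorem flipHomG_injective : Function.Injective (flipHomG (G := G) (κ := κ)) :=
  (Equiv.permCongrHom (Fintype.equivFin (G × κ))).injective.comp flipHomAuxG_injective

/-- **Every finite abelian group program is ONE PERM gate on `|G|·|κ|` points**: rows `ρ i ∈ G^κ` owned by
wires, target `t`; accept `v` iff `t` lies in the subgroup generated by the rows of the on-wires. For
`G = ZMod p`, `p` prime, this is every monotone span program over `𝔽_p` of dimension `|κ|` (the additive
closure in `𝔽_p^κ` is the `𝔽_p`-span). [folklore] -/
theorem abelianProgram_isPermGate {n : ℕ} (ρ : Fin n → κ → G) (t : κ → G)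
    (f : (Fin n → Bool) → Bool)
    (hf : ∀ v, f v = true ↔ Multiplicative.ofAdd t ∈
      Subgroup.closure ((fun i => Multiplicative.ofAdd (ρ i)) '' {i | v i = true})) :
    IsPermGate (Fintype.card (G × κ)) ⟨n, f⟩ := by
  refine ⟨_, le_rfl, fun i => flipHomG (Multiplicative.ofAdd (ρ i)), flipHomG (Multiplicative.ofAdd t),
    fun v => ?_⟩
  show f v = true ↔ _
  rw [hf v]
  have himg : (fun i : Fin n => flipHomG (Multiplicative.ofAdd (ρ i))) '' {i | v i = true} =
      flipHomG '' ((fun i => Multiplicative.ofAdd (ρ i)) '' {i | v i = true}) :=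
    (Set.image_image _ _ _).symm
  rw [himg, ← MonoidHom.map_closure, Subgroup.mem_map_iff_mem flipHomG_injective]

omit [AddCommGroup G] in
/-- Width bookkeeping: `|G × κ| = |G|·|κ|`. [folklore] -/
theorem card_group_prod : Fintype.card (G × κ) = Fintype.card G * Fintype.card κ :=
  Fintype.card_prod _ _

end Abelian

/-! ### 7.6 Sanity implication: the crux gives a superpolynomial 𝔽₂-mSP DIMENSION lower bound for CLIQUE -/

/-- **The crux implies an 𝔽₂ monotone-span-program dimension lower bound**: if `CliqueExtLowerBound`
holds with exponent `δ`, then for every `c`, eventually in `m`, NO 𝔽₂ span program of dimension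
`|κ| ≤ m^c / 2` — any number `n` of rows `ρ i`, row `i` labelled by the edge `w i`, target `t` —
computes CLIQUE(m, ⌈m^δ⌉₊) (it would be one PERM gate on `2|κ| ≤ m^c` points). [folklore] -/
theorem msp_dim_lower_bound_of_cliqueExtLowerBound (h : CliqueExtLowerBound) :
    ∃ δ : ℝ, 0 < δ ∧ δ < 1 / 2 ∧ ∀ c : ℕ, ∀ᶠ m : ℕ in atTop,
      ∀ (κ : Type) [Fintype κ] (n : ℕ) (ρ : Fin n → κ → ZMod 2) (t : κ → ZMod 2)
        (w : Fin n → (⊤ : SimpleGraph (Fin m)).edgeSet), 2 * Fintype.card κ ≤ m ^ c →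
        ¬ ∀ x : (⊤ : SimpleGraph (Fin m)).edgeSet → Bool, cliqueFn m ⌈(m : ℝ) ^ δ⌉₊ x = true ↔
          Multiplicative.ofAdd t ∈ Subgroup.closure
            ((fun i => Multiplicative.ofAdd (ρ i)) '' {i | x (w i) = true}) := by
  classical
  obtain ⟨δ, hδ0, hδ1, hLB⟩ := cliqueExtLowerBound_iff.1 h
  refine ⟨δ, hδ0, hδ1, fun c => ?_⟩
  filter_upwards [hLB c, eventually_ge_atTop 1] with m hm h1 κ _ n ρ t w hcard hcomp
  -- the span program is one PERM gate of width 2|κ| ≤ m^c, wired by `w`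
  let f : (Fin n → Bool) → Bool := fun v => decide (Multiplicative.ofAdd t ∈ Subgroup.closure
    ((fun i => Multiplicative.ofAdd (ρ i)) '' {i | v i = true}))
  have hf : ∀ v, f v = true ↔ Multiplicative.ofAdd t ∈ Subgroup.closure
      ((fun i => Multiplicative.ofAdd (ρ i)) '' {i | v i = true}) := fun v => decide_eq_true_iff
  have hgate : IsPermGate (m ^ c) ⟨n, f⟩ :=
    (spanGate_isPermGate ρ t f hf).mono (by rw [card_zmod_two_prod]; exact hcard)
  obtain ⟨C, hC, hs, he⟩ := (CktSize.gate (B := extGate (m ^ c)) ⟨n, f⟩ hgate.mem_extGate w).toCircuit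
  refine hm C hC (hs.trans (Nat.one_le_pow _ _ h1)) fun x => ?_
  rw [he x, Bool.eq_iff_iff]
  show f (fun a => x (w a)) = true ↔ _
  rw [hf, hcomp x]

/-! ## §8 Certified vs uncertified rejection of a CONV gate (probe requested by card `certificates-on-the-defect`) -/

section Certified

open Matrix

/-- A Farkas certificate of rejection of the CONV data `(A, b, B)` at the input `v`: `y ≥ 0` with
`∑ yᵢ Aᵢ ⪰ 0` and `y · (b + B v) < 0`. [folklore] -/
def HasCertificate {p q n : ℕ} (A : Fin p → Matrix (Fin q) (Fin q) ℝ) (b : Fin p → ℝ)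
    (B : Fin p → Fin n → ℝ) (v : Fin n → Bool) : Prop :=
  ∃ y : Fin p → ℝ, (∀ i, 0 ≤ y i) ∧ (∑ i, y i • A i).PosSemidef ∧
    ∑ i, y i * (b i + ∑ j, B i j * (if v j then (1 : ℝ) else 0)) < 0

/-- The quadratic form of a real `2 × 2` matrix at `(s, t)`. [folklore] -/
theorem quadForm_fin_two (M : Matrix (Fin 2) (Fin 2) ℝ) (s t : ℝ) :
    star ![s, t] ⬝ᵥ (M *ᵥ ![s, t]) = s * (M 0 0 * s + M 0 1 * t) + t * (M 1 0 * s + M 1 1 * t) := by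
  simp [Matrix.mulVec, dotProduct, Fin.sum_univ_two]

/-- In a real psd `2 × 2` matrix a vanishing diagonal entry kills its row. [folklore] -/
theorem offDiag_eq_zero_of_posSemidef {Y : Matrix (Fin 2) (Fin 2) ℝ} (hY : Y.PosSemidef)
    (h00 : Y 0 0 = 0) : Y 0 1 = 0 := by
  have hsymm : Y 1 0 = Y 0 1 := by
    have h := hY.1.apply 1 0
    simp only [star_trivial] at h
    exact h.symm
  by_contra hne
  have hq := hY.dotProduct_mulVec_nonneg ![-(Y 1 1 + 1) / (2 * Y 0 1), 1]
  rw [quadForm_fin_two, h00, hsymm] at hq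
  have : -(Y 1 1 + 1) / (2 * Y 0 1) * (0 * (-(Y 1 1 + 1) / (2 * Y 0 1)) + Y 0 1 * 1) +
      1 * (Y 0 1 * (-(Y 1 1 + 1) / (2 * Y 0 1)) + Y 1 1 * 1) = -1 := by
    field_simp
    ring
  linarith

/-- **CONV gates, as typed, may reject WITHOUT a Farkas certificate** (weak infeasibility): the data
`A₀ = E₀₀, b₀ = 0, B₀ = 0; A₁ = -(E₀₁ + E₁₀), b₁ = -2, B₁ = 2` realise the IDENTITY gate `v ↦ v₀`
(width `p + q = 4`, `B ≥ 0`), and the rejection at `v₀ = 0` — the system `Y ⪰ 0, Y₀₀ ≤ 0, Y₀₁ + Y₁₀ ≥ 2` —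
is infeasible (psd with `Y₀₀ = 0` forces `Y₀₁ = 0`) yet uncertified (`y₀ E₀₀ - y₁ (E₀₁ + E₁₀) ⪰ 0` forces
`y₁ = 0`). So "every rejection is certified" is a property of the REALISATION, not of the gate: an argument
through certificates (card `certificates-on-the-defect`) must first re-realise its CONV gates; for the LP
sub-class (diagonal data) Farkas makes every rejection certified. Whether every CONV-realisable Boolean
function has a fully certified realisation of comparable width is OPEN here. [folklore] -/
theorem exists_convData_uncertified_rejection :
    ∃ (A : Fin 2 → Matrix (Fin 2) (Fin 2) ℝ) (b : Fin 2 → ℝ) (B : Fin 2 → Fin 1 → ℝ),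
      (∀ i j, 0 ≤ B i j) ∧
      (∀ v : Fin 1 → Bool, (∃ Y : Matrix (Fin 2) (Fin 2) ℝ, Y.PosSemidef ∧
          ∀ i, (A i * Y).trace ≤ b i + ∑ j, B i j * (if v j then (1 : ℝ) else 0)) ↔ v 0 = true) ∧
      ¬ HasCertificate A b B (fun _ => false) := by
  refine ⟨![Matrix.single 0 0 1, -(Matrix.single 0 1 1 + Matrix.single 1 0 1)], ![0, -2],
    ![fun _ => 0, fun _ => 2], ?_, ?_, ?_⟩
  · intro i j
    fin_cases i <;> simp
  · intro v
    have htr0 : ∀ Y : Matrix (Fin 2) (Fin 2) ℝ, (Matrix.single 0 0 (1 : ℝ) * Y).trace = Y 0 0 := by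
      intro Y; rw [Matrix.trace_single_mul, smul_eq_mul, one_mul]
    have htr1 : ∀ Y : Matrix (Fin 2) (Fin 2) ℝ,
        (-(Matrix.single 0 1 (1 : ℝ) + Matrix.single 1 0 1) * Y).trace = -(Y 1 0 + Y 0 1) := by
      intro Y
      rw [Matrix.neg_mul, Matrix.trace_neg, Matrix.add_mul, Matrix.trace_add, Matrix.trace_single_mul,
        Matrix.trace_single_mul, smul_eq_mul, smul_eq_mul, one_mul, one_mul]
    constructor
    · rintro ⟨Y, hY, hc⟩
      by_contra hv
      have hv' : v 0 = false := by simpa using hv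
      have h0 := hc 0
      have h1 := hc 1
      simp only [Matrix.cons_val_zero, Matrix.cons_val_one, Fin.sum_univ_one, hv',
        Bool.false_eq_true, if_false, mul_zero, add_zero, htr0, htr1] at h0 h1
      have hnn : 0 ≤ Y 0 0 := hY.diag_nonneg
      have h00 : Y 0 0 = 0 := le_antisymm h0 hnn
      have h01 : Y 0 1 = 0 := offDiag_eq_zero_of_posSemidef hY h00
      have h10 : Y 1 0 = 0 := by
        have h := hY.1.apply 1 0
        simp only [star_trivial, h01] at h
        exact h.symm
      linarith
    · intro hv
      refine ⟨0, Matrix.PosSemidef.zero, fun i => ?_⟩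
      fin_cases i
      · simp
      · simp [hv]
  · rintro ⟨y, hy, hpsd, hobj⟩
    simp only [Fin.sum_univ_two, Matrix.cons_val_zero, Matrix.cons_val_one,
      Fin.sum_univ_one, Bool.false_eq_true, if_false, mul_zero, add_zero] at hobj hpsd
    -- the certificate matrix `y₀ E₀₀ - y₁ (E₀₁ + E₁₀)` is psd only if `y₁ = 0`
    have hy1 : y 1 = 0 := by
      by_contra hne
      have hpos : 0 < y 1 := lt_of_le_of_ne (hy 1) (Ne.symm hne)
      have hq := hpsd.dotProduct_mulVec_nonneg ![1, (y 0 + 1) / (2 * y 1)]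
      rw [quadForm_fin_two] at hq
      simp [Matrix.add_apply, Matrix.neg_apply] at hq
      have : y 0 - y 1 * ((y 0 + 1) / (2 * y 1)) - (y 0 + 1) / (2 * y 1) * y 1 = -1 := by
        field_simp
        ring
      nlinarith
    rw [hy1] at hobj
    norm_num at hobj

end Certified

/-! ## §9 (session 2, LANDED) The refuted regime `m − k = Θ(log m)` — colour-coding + 2-SAT cuts

The gen-2 construction (927 + 334 lines: skew-symmetric implication relations, the identity
CLIQUE(m, m−k) = ⋁_{h∈𝓗} ⋀_u (Cut ∨ Cut), reachability DP as a circuit, Mehlhorn–Schmidt perfect hashing,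
constant elimination over `{∧₂, ∨₂}`) is LANDED as
`Theorems/CliqueExtLowerBound/Negative/LargeCliquesTwoSat|Circuit|Hashing|Monotone.lean` (p75414, p75593,
p76649, p77262) and imported above (gen 3 dropped the inline copy to keep this work file under the crux
write limit); the headline statements are re-exported here in this file's vocabulary (`LowerBoundAt` of §0
is definitionally the landed `Negative.LowerBoundAt`). -/

section LargeCliquesLanded

/-- **`¬ LowerBoundAt (m − c·⌊log₃ m⌋)`** (`c ≥ 1`): the crux's lower bound at the schedule
`k = m − Θ(log m)` is FALSE although `C(m, c log m)` is superpolynomial (landed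
`Negative.not_lowerBoundAt_sub_clog`). [folklore] -/
theorem not_lowerBoundAt_sub_clog (c : ℕ) (hc : 1 ≤ c) : ¬ LowerBoundAt fun m => m - c * Nat.log 3 m :=
  Summit.PneNP.PneNP.Theorems.CliqueExtLowerBound.Negative.not_lowerBoundAt_sub_clog c hc

/-- Polynomial `{∧₂, ∨₂}`-circuits (no constants) for CLIQUE(m, m − c·⌊log₃ m⌋), `c ≥ 1`, `≤ m^{c+7}` gates
(landed `Negative.exists_monotone_circuit_largeClique`; sharpens Andreev–Jukna's `m − k = O(√log m)`).
[folklore] -/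
theorem exists_monotone_circuit_largeClique (c : ℕ) (hc : 1 ≤ c) :
    ∀ᶠ m : ℕ in atTop, ∃ C : Circuit ((⊤ : SimpleGraph (Fin m)).edgeSet), C.IsOver monotoneBasis ∧
      C.size ≤ m ^ (c + 7) ∧ C.Computes (cliqueFn m (m - c * Nat.log 3 m)) :=
  Summit.PneNP.PneNP.Theorems.CliqueExtLowerBound.Negative.exists_monotone_circuit_largeClique c hc

end LargeCliquesLanded

/-! ## §10 (NEW, gen 3) Apex padding of extended monotone circuits; schedule transfer

`CLIQUE(m', k')` is the restriction of `CLIQUE(m, k' + (m - m'))` switching on every edge at the `m - m'`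
apexes; a restriction of a `B_s`-circuit is a `B_s`-circuit (`≤ #E(K_m)` extra constant gates, constants =
GRANK₀ gates). Hence `LowerBoundAt k' → LowerBoundAt k` whenever eventually `k m = k' m' + (m - m')` for
some `m' ≤ m ≤ m'^2` (landing: `Negative/Padding.lean`). -/

section Gen3Padding

/-! ## §1 Apex padding of the clique function -/

section Padding

/-- Edge slots of `K_m`. [folklore] -/
abbrev E (m : ℕ) : Type := (⊤ : SimpleGraph (Fin m)).edgeSet

variable {m' m : ℕ} (hm : m' ≤ m)

/-- The edge of `K_m` over an edge of `K_{m'}` (`m' ≤ m`, vertices embedded by `Fin.castLE`). [folklore] -/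
def embE (e : E m') : E m :=
  ⟨(e : Sym2 (Fin m')).map (Fin.castLE hm), by
    obtain ⟨e, he⟩ := e
    induction e using Sym2.ind with
    | h a b =>
      have hab : a ≠ b := (SimpleGraph.top_adj a b).1 ((SimpleGraph.mem_edgeSet ⊤).1 he)
      rw [Sym2.map_mk, SimpleGraph.mem_edgeSet, SimpleGraph.top_adj]
      exact fun h => hab (Fin.castLE_injective hm h)⟩

/-- `embE` is injective. [folklore] -/
theorem embE_injective : Function.Injective (embE hm) := by
  intro e₁ e₂ h
  apply Subtype.ext
  have h' := congrArg Subtype.val h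
  exact Sym2.map.injective (Fin.castLE_injective hm) h'

open scoped Classical in
/-- Extension of an edge vector of `K_{m'}` to `K_m`: live edges keep their value, every edge at an
apex vertex is switched on. [folklore] -/
noncomputable def extV (x' : E m' → Bool) (e : E m) : Bool :=
  if h : ∃ e', embE hm e' = e then x' h.choose else true

/-- Live edges keep their value. [folklore] -/
theorem extV_embE (x' : E m' → Bool) (e' : E m') : extV hm x' (embE hm e') = x' e' := by
  classical
  unfold extV
  have h : ∃ e'', embE hm e'' = embE hm e' := ⟨e', rfl⟩
  rw [dif_pos h, embE_injective hm h.choose_spec]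

/-- Apex edges are on. [folklore] -/
theorem extV_of_not_range (x' : E m' → Bool) (e : E m) (he : ∀ e', embE hm e' ≠ e) :
    extV hm x' e = true := by
  classical
  unfold extV
  rw [dif_neg fun ⟨e', h⟩ => he e' h]

/-- An edge of `K_m` both of whose endpoints are live is in the range of `embE`. [folklore] -/
theorem exists_embE_of_lt {u v : Fin m} (huv : s(u, v) ∈ (⊤ : SimpleGraph (Fin m)).edgeSet)
    (hu : (u : ℕ) < m') (hv : (v : ℕ) < m') : ∃ e', embE hm e' = ⟨s(u, v), huv⟩ := by
  have hne : u ≠ v := (SimpleGraph.top_adj u v).1 ((SimpleGraph.mem_edgeSet ⊤).1 huv)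
  have hne' : (⟨u, hu⟩ : Fin m') ≠ ⟨v, hv⟩ := fun h => hne (Fin.ext (Fin.mk.inj_iff.1 h))
  refine ⟨⟨s(⟨u, hu⟩, ⟨v, hv⟩), (SimpleGraph.mem_edgeSet ⊤).2 ((SimpleGraph.top_adj _ _).2 hne')⟩,
    Subtype.ext ?_⟩
  simp [embE, Fin.castLE]

/-- An edge in the range of `embE` has live endpoints. [folklore] -/
theorem lt_of_embE_eq {u v : Fin m} {huv : s(u, v) ∈ (⊤ : SimpleGraph (Fin m)).edgeSet}
    {e' : E m'} (h : embE hm e' = ⟨s(u, v), huv⟩) : (u : ℕ) < m' ∧ (v : ℕ) < m' := by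
  obtain ⟨e', he'⟩ := e'
  induction e' using Sym2.ind with
  | h a b =>
    have h' := congrArg Subtype.val h
    simp only [embE, Sym2.map_mk] at h'
    rcases Sym2.eq_iff.1 h' with ⟨rfl, rfl⟩ | ⟨rfl, rfl⟩
    · exact ⟨a.2, b.2⟩
    · exact ⟨b.2, a.2⟩

/-- **Apex padding.** `CLIQUE(m, k' + (m - m'))` on the extended vector is `CLIQUE(m', k')`: a clique of
the padded graph loses at most the `m - m'` apexes when restricted to the live part, and a live clique
plus all apexes is a clique of the padded graph. [folklore] -/
theorem cliqueFn_extV (x' : E m' → Bool) (k' : ℕ) :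
    cliqueFn m (k' + (m - m')) (extV hm x') = cliqueFn m' k' x' := by
  classical
  rw [Bool.eq_iff_iff, CliqueLPGate.cliqueFn_eq_true_iff_exists,
    CliqueLPGate.cliqueFn_eq_true_iff_exists]
  -- the apex (dead) vertices
  set Dd : Finset (Fin m) := Finset.univ.filter fun v => m' ≤ (v : ℕ) with hDd
  have hDcard : Dd.card = m - m' := by
    have h1 : Dd = Finset.univ \ Finset.univ.map (Fin.castLEEmb hm) := by
      ext v
      simp only [hDd, Finset.mem_filter, Finset.mem_univ, true_and, Finset.mem_sdiff,
        Finset.mem_map, Fin.castLEEmb_apply, not_exists]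
      constructor
      · intro hv a ha
        have : ((Fin.castLE hm a : Fin m) : ℕ) = v := by rw [ha]
        simp at this; omega
      · intro h
        by_contra hlt
        push Not at hlt
        exact h ⟨v, hlt⟩ (Fin.ext rfl)
    rw [h1, Finset.card_sdiff_of_subset (Finset.subset_univ _), Finset.card_map, Finset.card_univ,
      Finset.card_univ, Fintype.card_fin, Fintype.card_fin]
  constructor
  · -- a clique of the padded graph restricts to a clique of the live part
    rintro ⟨S, hS, hx⟩
    set T : Finset (Fin m') := Finset.univ.filter fun a => Fin.castLE hm a ∈ S with hT
    have hTcard : k' ≤ T.card := by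
      have hsub : S ⊆ T.map (Fin.castLEEmb hm) ∪ Dd := by
        intro v hv
        by_cases hlt : (v : ℕ) < m'
        · refine Finset.mem_union_left _ (Finset.mem_map.2 ⟨⟨v, hlt⟩, ?_, Fin.ext rfl⟩)
          simp only [hT, Finset.mem_filter, Finset.mem_univ, true_and]
          have : Fin.castLE hm ⟨v, hlt⟩ = v := Fin.ext rfl
          rwa [this]
        · exact Finset.mem_union_right _ (by simp [hDd]; omega)
      have := (Finset.card_le_card hsub).trans (Finset.card_union_le _ _)
      rw [Finset.card_map, hDcard, hS] at this
      omega
    obtain ⟨T₀, hT₀T, hT₀⟩ := Finset.exists_subset_card_eq hTcard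
    refine ⟨T₀, hT₀, fun e' he' => ?_⟩
    obtain ⟨e', heE⟩ := e'
    induction e' using Sym2.ind with
    | h a b =>
      have ha : Fin.castLE hm a ∈ S := by
        have := hT₀T (he' a (Sym2.mem_mk_left a b)); simp [hT] at this; exact this
      have hb : Fin.castLE hm b ∈ S := by
        have := hT₀T (he' b (Sym2.mem_mk_right a b)); simp [hT] at this; exact this
      rw [← extV_embE hm x']
      refine hx _ fun y hy => ?_
      simp only [embE, Sym2.map_mk, Sym2.mem_iff] at hy
      rcases hy with rfl | rfl
      · exact ha
      · exact hb
  · -- a live clique plus all apexes is a clique of the padded graph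
    rintro ⟨T, hT, hx⟩
    refine ⟨T.map (Fin.castLEEmb hm) ∪ Dd, ?_, fun e he => ?_⟩
    · rw [Finset.card_union_of_disjoint, Finset.card_map, hT, hDcard]
      rw [Finset.disjoint_left]
      intro v hv hvD
      obtain ⟨a, -, rfl⟩ := Finset.mem_map.1 hv
      simp [hDd, Fin.castLEEmb] at hvD
      exact absurd a.2 (not_lt.2 hvD)
    · obtain ⟨e, heE⟩ := e
      induction e using Sym2.ind with
      | h u v =>
        by_cases hlive : (u : ℕ) < m' ∧ (v : ℕ) < m'
        · obtain ⟨e', he'⟩ := exists_embE_of_lt hm heE hlive.1 hlive.2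
          rw [← he', extV_embE]
          apply hx
          intro y hy
          have hu := he _ (Sym2.mem_mk_left u v)
          have hv := he _ (Sym2.mem_mk_right u v)
          have key : ∀ w : Fin m, w ∈ T.map (Fin.castLEEmb hm) ∪ Dd → (w : ℕ) < m' →
              ∀ a : Fin m', Fin.castLE hm a = w → a ∈ T := by
            intro w hw hwlt a ha
            rcases Finset.mem_union.1 hw with hw | hw
            · obtain ⟨a', ha', rfl⟩ := Finset.mem_map.1 hw
              have : a = a' := Fin.castLE_injective hm (by rw [ha]; rfl)
              rwa [this]
            · simp [hDd] at hw; omega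
          obtain ⟨e'v, he'E⟩ := e'
          induction e'v using Sym2.ind with
          | h a b =>
            have h' := congrArg Subtype.val he'
            simp only [embE, Sym2.map_mk] at h'
            simp only [Sym2.mem_iff] at hy
            rcases Sym2.eq_iff.1 h' with ⟨hau, hbv⟩ | ⟨hav, hbu⟩
            · rcases hy with rfl | rfl
              · exact key u hu hlive.1 _ hau
              · exact key v hv hlive.2 _ hbv
            · rcases hy with rfl | rfl
              · exact key v hv hlive.2 _ hav
              · exact key u hu hlive.1 _ hbu
        · apply extV_of_not_range
          intro e' h
          exact hlive (lt_of_embE_eq hm h)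

end Padding

/-! ## §2 Padding a circuit over any basis containing the constant `true` -/

section Circuits

/-- The constant `true` of any arity is a GRANK gate of dimension `0` (threshold `θ = 0`). [folklore] -/
theorem isGRankGate_constTrue (n : ℕ) : IsGRankGate 0 ⟨n, fun _ => true⟩ :=
  ⟨ℚ, inferInstance, 0, 0, le_rfl, 0, 0, fun _ => by simp⟩

/-- The constant `true` of any arity is a CONV gate of width `0` (`p = q = 0`: the empty SDP is feasible).
[folklore] -/
theorem isConvGate_constTrue (n : ℕ) : IsConvGate 0 ⟨n, fun _ => true⟩ :=
  ⟨0, 0, le_rfl, fun i => i.elim0, fun i => i.elim0, fun i => i.elim0, fun i => i.elim0, fun _ =>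
    ⟨fun _ => ⟨0, Matrix.PosSemidef.zero, fun i => i.elim0⟩, fun _ => rfl⟩⟩

/-- The constant `true` of any arity lies in the extended basis `B_s` for every `s`. [folklore] -/
theorem constTrue_mem_extGate (s n : ℕ) : (⟨n, fun _ => true⟩ : GateFn) ∈ extGate s :=
  ((isGRankGate_constTrue n).mono (Nat.zero_le s)).mem_extGate

/-- A circuit is a straight-line program realising its own function (converse of
`CktSize.toCircuit`). [folklore] -/
theorem cktSize_ofCircuit {ι : Type*} {B : Set GateFn} (C : Circuit ι) (hB : C.IsOver B) :
    CktSize B (fun x (_ : Unit) => C.eval x) C.size :=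
  ⟨C.gates, fun _ => C.output, le_rfl,
    ⟨GateList.wf_gates C, hB, fun _ n hn => C.wf_output n hn,
      fun x _ => (GateList.circuit_eval C x).symm⟩⟩

variable {m' m : ℕ} (hm : m' ≤ m)

/-- The padding map `x' ↦ extV x'` costs at most `#E(K_m)` gates over any basis `B` containing the
arity-`0` constant `true` (a projection for a live edge, one constant gate for an apex edge). [folklore] -/
theorem cktSize_extV {B : Set GateFn} (hB : (⟨0, fun _ => true⟩ : GateFn) ∈ B) :
    CktSize B (fun (x' : E m' → Bool) (e : E m) => extV hm x' e) (Fintype.card (E m) * 1) := by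
  classical
  refine CktSize.pi_const fun e => ?_
  by_cases h : ∃ e', embE hm e' = e
  · refine ((CktSize.proj B fun _ : Unit => h.choose).of_le (Nat.zero_le 1)).congr fun x' _ => ?_
    show x' h.choose = extV hm x' e
    unfold extV
    rw [dif_pos h]
  · refine (CktSize.gate (B := B) (⟨0, fun _ => true⟩ : GateFn) hB Fin.elim0).congr fun x' _ => ?_
    show true = extV hm x' e
    unfold extV
    rw [dif_neg h]

/-- **Restriction of a circuit along the padding**: a `B`-circuit on the edges of `K_m` computing `f`
yields a `B`-circuit on the edges of `K_{m'}` computing `x' ↦ f (extV x')`, with at most `#E(K_m)` extra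
gates, for any basis `B` containing the arity-`0` constant `true`. [folklore] -/
theorem exists_circuit_extV {B : Set GateFn} (hB : (⟨0, fun _ => true⟩ : GateFn) ∈ B)
    (C : Circuit (E m)) (hC : C.IsOver B) {f : (E m → Bool) → Bool} (hf : C.Computes f) :
    ∃ C' : Circuit (E m'), C'.IsOver B ∧ C'.size ≤ Fintype.card (E m) + C.size ∧
      C'.Computes fun x' => f (extV hm x') := by
  obtain ⟨C', hC', hs, he⟩ := ((cktSize_extV hm hB).comp (cktSize_ofCircuit C hC)).toCircuit
  refine ⟨C', hC', by simpa using hs, fun x' => ?_⟩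
  rw [he x']
  exact hf _

end Circuits

/-! ## §3 Schedule transfer by padding, over any monotone basis family with constants -/

section Transfer

/-- Lower bound at schedule `k` over a basis FAMILY `basis : ℕ → Set GateFn` (size parameter ↦ basis):
for every `c`, eventually no `basis (m^c)`-circuit with `≤ m^c` gates computes `CLIQUE(m, k m)`. The
crux's `LowerBoundAt` is the case `basis = extGate` (`lowerBoundAt_iff_over`); cruxes #2 / #4
(`ConvexGateBlind`, `LinAlgGateBlind`) are the CONV-only / PERM+GRANK-only families. [folklore] -/
def LowerBoundAtOver (basis : ℕ → Set GateFn) (k : ℕ → ℕ) : Prop :=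
  ∀ c : ℕ, ∀ᶠ m : ℕ in atTop, ∀ C : Circuit ((⊤ : SimpleGraph (Fin m)).edgeSet),
    C.IsOver (basis (m ^ c)) → C.size ≤ m ^ c → ¬ C.Computes (cliqueFn m (k m))

/-- `LowerBoundAt k` is `LowerBoundAtOver extGate k` (definitional). [folklore] -/
theorem lowerBoundAt_iff_over {k : ℕ → ℕ} : LowerBoundAt k ↔ LowerBoundAtOver extGate k := Iff.rfl

/-- `#E(K_m) ≤ m^2`. [folklore] -/
theorem card_E_le (m : ℕ) : Fintype.card (E m) ≤ m ^ 2 := CliqueLPGate.nE_le m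

/-- Size bookkeeping: `m^2 + m^c ≤ m'^(2c+5)` once `m ≤ m'^2` and `2 ≤ m'`. [folklore] -/
theorem pad_size_le {m m' c : ℕ} (hmm : m ≤ m' ^ 2) (h2 : 2 ≤ m') :
    m ^ 2 + m ^ c ≤ m' ^ (2 * c + 5) := by
  have h1 : 1 ≤ m' := by omega
  have hc : m ^ c ≤ m' ^ (2 * c + 4) :=
    calc m ^ c ≤ (m' ^ 2) ^ c := Nat.pow_le_pow_left hmm c
      _ = m' ^ (2 * c) := by rw [← pow_mul]
      _ ≤ m' ^ (2 * c + 4) := Nat.pow_le_pow_right h1 (by omega)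
  have h2' : m ^ 2 ≤ m' ^ (2 * c + 4) :=
    calc m ^ 2 ≤ (m' ^ 2) ^ 2 := Nat.pow_le_pow_left hmm 2
      _ = m' ^ 4 := by rw [← pow_mul]
      _ ≤ m' ^ (2 * c + 4) := Nat.pow_le_pow_right h1 (by omega)
  calc m ^ 2 + m ^ c ≤ m' ^ (2 * c + 4) + m' ^ (2 * c + 4) := add_le_add h2' hc
    _ = 2 * m' ^ (2 * c + 4) := by ring
    _ ≤ m' * m' ^ (2 * c + 4) := Nat.mul_le_mul_right _ h2
    _ = m' ^ (2 * c + 5) := by ring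

/-- **Padding transfers refutations downward in the schedule** (generic basis family, monotone in the
size parameter and containing the arity-`0` constant `true` at every level). If eventually every `m`
admits an `m' ≤ m ≤ m'^2`, `m' ≥ 2`, with `k m = k' m' + (m - m')`, then a polynomial circuit family
computing `CLIQUE(m, k m)` infinitely often restricts (`exists_circuit_extV`, `cliqueFn_extV`) to one
computing `CLIQUE(m', k' m')` infinitely often. [folklore] -/
theorem not_lowerBoundAtOver_of_padding {basis : ℕ → Set GateFn} (hmono : Monotone basis)
    (hconst : ∀ s, (⟨0, fun _ => true⟩ : GateFn) ∈ basis s) {k k' : ℕ → ℕ}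
    (H : ∀ᶠ m : ℕ in atTop, ∃ m', m' ≤ m ∧ m ≤ m' ^ 2 ∧ 2 ≤ m' ∧ k m = k' m' + (m - m'))
    (h : ¬ LowerBoundAtOver basis k) : ¬ LowerBoundAtOver basis k' := by
  simp only [LowerBoundAtOver, not_forall, Filter.not_eventually, not_not] at h ⊢
  obtain ⟨c, hc⟩ := h
  refine ⟨2 * c + 5, ?_⟩
  rw [Filter.frequently_atTop]
  intro N
  obtain ⟨m, ⟨⟨m', hm'm, hmm', h2, hk⟩, hmN⟩, C, hC, hsize, hcomp⟩ :=
    ((H.and (eventually_ge_atTop (N ^ 2))).and_frequently hc).exists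
  have hN : N ≤ m' := by
    by_contra hlt
    push Not at hlt
    have : m' ^ 2 < N ^ 2 := Nat.pow_lt_pow_left hlt (by norm_num)
    omega
  refine ⟨m', hN, ?_⟩
  obtain ⟨C', hC', hs', hcomp'⟩ := exists_circuit_extV hm'm (hconst _) C hC hcomp
  refine ⟨C', hC'.mono (hmono ?_), ?_, fun x' => ?_⟩
  · exact le_trans (Nat.le_add_left _ _) (pad_size_le (c := c) hmm' h2)
  · exact hs'.trans ((add_le_add (card_E_le m) hsize).trans (pad_size_le hmm' h2))
  · rw [hcomp' x']
    dsimp only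
    rw [hk, cliqueFn_extV]

/-- **Hardness propagates upward along paddings** (generic, contrapositive form). [folklore] -/
theorem LowerBoundAtOver.of_padding {basis : ℕ → Set GateFn} (hmono : Monotone basis)
    (hconst : ∀ s, (⟨0, fun _ => true⟩ : GateFn) ∈ basis s) {k k' : ℕ → ℕ}
    (h : LowerBoundAtOver basis k')
    (H : ∀ᶠ m : ℕ in atTop, ∃ m', m' ≤ m ∧ m ≤ m' ^ 2 ∧ 2 ≤ m' ∧ k m = k' m' + (m - m')) :
    LowerBoundAtOver basis k := by
  by_contra hk
  exact not_lowerBoundAtOver_of_padding hmono hconst H hk h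

/-- The extended basis is monotone in its size parameter. [folklore] -/
theorem extGate_monotoneFamily : Monotone extGate := fun _ _ hst => extGate_mono hst

/-- The crux's case: `¬ LowerBoundAt k → ¬ LowerBoundAt k'` under the padding hypothesis. [folklore] -/
theorem not_lowerBoundAt_of_padding {k k' : ℕ → ℕ}
    (H : ∀ᶠ m : ℕ in atTop, ∃ m', m' ≤ m ∧ m ≤ m' ^ 2 ∧ 2 ≤ m' ∧ k m = k' m' + (m - m'))
    (h : ¬ LowerBoundAt k) : ¬ LowerBoundAt k' :=
  not_lowerBoundAtOver_of_padding extGate_monotoneFamily (fun s => constTrue_mem_extGate s 0) H h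

/-- The crux's case: hardness propagates upward along paddings. [folklore] -/
theorem LowerBoundAt.of_padding {k k' : ℕ → ℕ} (h : LowerBoundAt k')
    (H : ∀ᶠ m : ℕ in atTop, ∃ m', m' ≤ m ∧ m ≤ m' ^ 2 ∧ 2 ≤ m' ∧ k m = k' m' + (m - m')) :
    LowerBoundAt k := by
  by_contra hk
  exact not_lowerBoundAt_of_padding H hk h

end Transfer

end Gen3Padding

/-! ## §11 (NEW, gen 3) THE HARD BAND and monotonicity in `δ`

`LowerBoundAt ⌈m^δ⌉₊` forces `LowerBoundAt k` for every schedule in the band `⌈m^δ⌉₊ ≤ k ≤ m - √m - 1`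
(discrete IVT for the defect `j - ⌈j^δ⌉₊`); so the crux is MONOTONE in `δ < 1`, equals hardness on a
whole interval `[δ₀, 1)`, and forces `LowerBoundAt (m/2)`, `LowerBoundAt (m - ⌈m^ε⌉₊)` (`1/2 < ε < 1`).
REFUTATION TARGET widened: poly `B`-circuits i.o. for `CLIQUE(m, k m)` at ANY ONE schedule with
`√m ≤ k ≤ m - √m - 1` kill the crux (landing: `Negative/DeltaMonotone.lean`). -/

section Gen3Band

open Summit.PneNP.PneNP.Theses.ConvexRankGates (LinAlgGateBlind ConvexGateBlind)

/-! ## §4 The discrete intermediate value theorem for the defect `j - ⌈j^δ⌉₊` -/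

section IVT

/-- A function `ℕ → ℕ` starting at `0` with steps `≤ 1` takes every value below `f N` on `[0, N]`.
[folklore] -/
theorem exists_eq_of_step_le_one {f : ℕ → ℕ} (h0 : f 0 = 0) (hstep : ∀ j, f (j + 1) ≤ f j + 1) :
    ∀ N v, v ≤ f N → ∃ j ≤ N, f j = v := by
  intro N
  induction N with
  | zero => intro v hv; exact ⟨0, le_rfl, by omega⟩
  | succ N ih =>
    intro v hv
    by_cases h : v ≤ f N
    · obtain ⟨j, hj, hfj⟩ := ih v h
      exact ⟨j, by omega, hfj⟩
    · exact ⟨N + 1, le_rfl, by have := hstep N; omega⟩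

/-- `⌈0^δ⌉₊ = 0` for `δ > 0`. [folklore] -/
theorem ceil_zero_rpow {δ : ℝ} (h0 : 0 < δ) : ⌈((0 : ℕ) : ℝ) ^ δ⌉₊ = 0 := by
  rw [Nat.cast_zero, Real.zero_rpow h0.ne', Nat.ceil_zero]

/-- The defect `j ↦ j - ⌈j^δ⌉₊` (`0 < δ`) takes every value up to its value at `N` on `[0, N]`
(its steps are `0` or `1` since `⌈·^δ⌉₊` is monotone). [folklore] -/
theorem exists_sub_ceil_eq {δ : ℝ} (h0 : 0 < δ) (N v : ℕ)
    (hv : v ≤ N - ⌈(N : ℝ) ^ δ⌉₊) : ∃ j ≤ N, j - ⌈(j : ℝ) ^ δ⌉₊ = v := by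
  refine exists_eq_of_step_le_one (f := fun j => j - ⌈(j : ℝ) ^ δ⌉₊) (by simp)
    (fun j => ?_) N v hv
  have hmono : ⌈(j : ℝ) ^ δ⌉₊ ≤ ⌈((j + 1 : ℕ) : ℝ) ^ δ⌉₊ :=
    Nat.ceil_mono (Real.rpow_le_rpow (Nat.cast_nonneg _) (by push_cast; linarith) h0.le)
  show (j + 1) - ⌈((j + 1 : ℕ) : ℝ) ^ δ⌉₊ ≤ (j - ⌈(j : ℝ) ^ δ⌉₊) + 1
  omega

/-- Eventually `2·(⌈m^δ⌉₊ + 1) ≤ m` for `δ < 1`. [folklore] -/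
theorem eventually_two_mul_ceil_rpow_le {δ : ℝ} (h1 : δ < 1) :
    ∀ᶠ m : ℕ in atTop, 2 * (⌈(m : ℝ) ^ δ⌉₊ + 1) ≤ m := by
  have hpos : 0 < 1 - δ := by linarith
  set R : ℝ := (4 : ℝ) ^ (1 / (1 - δ)) with hR
  filter_upwards [eventually_ge_atTop (max 8 ⌈R⌉₊)] with m hm
  have hm8 : 8 ≤ m := le_of_max_le_left hm
  have hmR : R ≤ m := (Nat.le_ceil R).trans (by exact_mod_cast le_of_max_le_right hm)
  have hm0 : (0 : ℝ) < m := by exact_mod_cast (show 0 < m by omega)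
  have h4 : (4 : ℝ) ≤ (m : ℝ) ^ (1 - δ) := by
    calc (4 : ℝ) = R ^ (1 - δ) := by
          rw [hR, ← Real.rpow_mul (by norm_num), one_div, inv_mul_cancel₀ hpos.ne', Real.rpow_one]
      _ ≤ (m : ℝ) ^ (1 - δ) := Real.rpow_le_rpow (by positivity) hmR hpos.le
  have hδ : (m : ℝ) ^ δ ≤ m / 4 := by
    have hsplit : (m : ℝ) = (m : ℝ) ^ δ * (m : ℝ) ^ (1 - δ) := by
      rw [← Real.rpow_add hm0, add_sub_cancel, Real.rpow_one]
    rw [le_div_iff₀ (by norm_num : (0 : ℝ) < 4)]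
    calc (m : ℝ) ^ δ * 4 ≤ (m : ℝ) ^ δ * (m : ℝ) ^ (1 - δ) :=
          mul_le_mul_of_nonneg_left h4 (by positivity)
      _ = m := hsplit.symm
  have hceil : (⌈(m : ℝ) ^ δ⌉₊ : ℝ) < (m : ℝ) ^ δ + 1 := Nat.ceil_lt_add_one (by positivity)
  have hreal : (2 : ℝ) * (⌈(m : ℝ) ^ δ⌉₊ + 1) ≤ m := by
    have : (8 : ℝ) ≤ m := by exact_mod_cast hm8
    linarith
  exact_mod_cast hreal

/-- Eventually `2·(Nat.sqrt m + 1) ≤ m`. [folklore] -/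
theorem eventually_two_mul_sqrt_le : ∀ᶠ m : ℕ in atTop, 2 * (Nat.sqrt m + 1) ≤ m := by
  filter_upwards [eventually_ge_atTop 16] with m hm
  have hs : 4 ≤ Nat.sqrt m := by
    rw [Nat.le_sqrt]
    omega
  have hss : Nat.sqrt m * Nat.sqrt m ≤ m := Nat.sqrt_le m
  nlinarith

/-- Eventually `⌈m^δ⌉₊ + Nat.sqrt m + 2 ≤ m` for `δ < 1`. [folklore] -/
theorem eventually_ceil_rpow_add_sqrt_le {δ : ℝ} (h1 : δ < 1) :
    ∀ᶠ m : ℕ in atTop, ⌈(m : ℝ) ^ δ⌉₊ + Nat.sqrt m + 2 ≤ m := by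
  filter_upwards [eventually_two_mul_ceil_rpow_le h1, eventually_two_mul_sqrt_le] with m h h'
  omega

end IVT

/-! ## §5 The hard band and monotonicity in `δ` -/

section Band

/-- The padding hypothesis inside the band: for a schedule `k` with `⌈m^δ⌉₊ ≤ k m ≤ m - Nat.sqrt m - 1`
eventually (`0 < δ ≤ 1`), eventually every `m` has an `m' ≤ m ≤ m'^2`, `m' ≥ 2`, with
`k m = ⌈m'^δ⌉₊ + (m - m')`: choose `m'` with `m' - ⌈m'^δ⌉₊ = m - k m` by the discrete IVT; then
`m' ≥ Nat.sqrt m + 1`. [folklore] -/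
theorem eventually_padding_of_band {δ : ℝ} (h0 : 0 < δ) (h1 : δ ≤ 1) {k : ℕ → ℕ}
    (hk : ∀ᶠ m : ℕ in atTop, ⌈(m : ℝ) ^ δ⌉₊ ≤ k m ∧ k m + Nat.sqrt m + 1 ≤ m) :
    ∀ᶠ m : ℕ in atTop, ∃ m', m' ≤ m ∧ m ≤ m' ^ 2 ∧ 2 ≤ m' ∧ k m = ⌈(m' : ℝ) ^ δ⌉₊ + (m - m') := by
  refine hk.mono fun m ⟨hlo, hhi⟩ => ?_
  have hkm : k m ≤ m := by omega
  set v := m - k m with hv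
  have hvk : v + k m = m := by omega
  obtain ⟨m', hm'm, hm'⟩ := exists_sub_ceil_eq h0 m v (by omega)
  have hk'le : ⌈(m' : ℝ) ^ δ⌉₊ ≤ m' := by
    rcases Nat.eq_zero_or_pos m' with h0' | hpos
    · rw [h0', ceil_zero_rpow h0]
    · exact ceil_rpow_le h1 hpos
  have hd : v + ⌈(m' : ℝ) ^ δ⌉₊ = m' := by omega
  have hs : Nat.sqrt m + 1 ≤ m' := by omega
  have hsq : 0 < Nat.sqrt m := Nat.sqrt_pos.2 (by omega)
  have h2 : 2 ≤ m' := by omega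
  refine ⟨m', hm'm, ?_, h2, ?_⟩
  · calc m ≤ m + 1 := Nat.le_succ m
      _ ≤ (Nat.sqrt m + 1) ^ 2 := Nat.succ_le_succ_sqrt' m
      _ ≤ m' ^ 2 := Nat.pow_le_pow_left hs 2
  · show k m = ⌈(m' : ℝ) ^ δ⌉₊ + (m - m')
    omega

/-- The band condition for the schedule `⌈m^δ⌉₊` itself relative to a smaller exponent `δ' ≤ δ < 1`.
[folklore] -/
theorem eventually_band_rpow {δ' δ : ℝ} (hle : δ' ≤ δ) (h1 : δ < 1) :
    ∀ᶠ m : ℕ in atTop, ⌈(m : ℝ) ^ δ'⌉₊ ≤ ⌈(m : ℝ) ^ δ⌉₊ ∧ ⌈(m : ℝ) ^ δ⌉₊ + Nat.sqrt m + 1 ≤ m := by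
  filter_upwards [eventually_ceil_rpow_add_sqrt_le h1, eventually_ge_atTop 1] with m hm hm1
  refine ⟨Nat.ceil_mono (Real.rpow_le_rpow_of_exponent_le (by exact_mod_cast hm1) hle), ?_⟩
  omega

/-! ### Generic form: any basis family monotone in the size parameter and containing the constant `true` -/

/-- **THE HARD BAND (generic basis family).** Hardness at the schedule `⌈m^δ⌉₊` (`0 < δ ≤ 1`) forces
hardness at every schedule `k` inside the band `⌈m^δ⌉₊ ≤ k m ≤ m - Nat.sqrt m - 1` (eventually), over any
basis family monotone in the size parameter with the arity-0 constant `true` at every level —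
`CLIQUE(m, k m)` pads down to `CLIQUE(m', ⌈m'^δ⌉₊)`. [folklore] -/
theorem LowerBoundAtOver.band {basis : ℕ → Set GateFn} (hmono : Monotone basis)
    (hconst : ∀ s, (⟨0, fun _ => true⟩ : GateFn) ∈ basis s) {δ : ℝ} (h0 : 0 < δ) (h1 : δ ≤ 1)
    (h : LowerBoundAtOver basis fun m => ⌈(m : ℝ) ^ δ⌉₊) {k : ℕ → ℕ}
    (hk : ∀ᶠ m : ℕ in atTop, ⌈(m : ℝ) ^ δ⌉₊ ≤ k m ∧ k m + Nat.sqrt m + 1 ≤ m) :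
    LowerBoundAtOver basis k :=
  h.of_padding hmono hconst (eventually_padding_of_band h0 h1 hk)

/-- **MONOTONICITY IN `δ` (generic basis family).** For `0 < δ' ≤ δ < 1`: hardness at `⌈m^δ'⌉₊` implies
hardness at `⌈m^δ⌉₊`. [folklore] -/
theorem lowerBoundAtOver_rpow_mono {basis : ℕ → Set GateFn} (hmono : Monotone basis)
    (hconst : ∀ s, (⟨0, fun _ => true⟩ : GateFn) ∈ basis s) {δ' δ : ℝ} (h0 : 0 < δ') (hle : δ' ≤ δ)
    (h1 : δ < 1) (h : LowerBoundAtOver basis fun m => ⌈(m : ℝ) ^ δ'⌉₊) :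
    LowerBoundAtOver basis fun m => ⌈(m : ℝ) ^ δ⌉₊ :=
  h.band hmono hconst h0 (hle.trans h1.le) (eventually_band_rpow hle h1)

/-! ### The crux's basis `extGate` -/

/-- **THE HARD BAND** for the crux's full basis: hardness at `⌈m^δ⌉₊` (`0 < δ ≤ 1`) forces hardness at
every schedule with `⌈m^δ⌉₊ ≤ k m ≤ m - Nat.sqrt m - 1` eventually. [folklore] -/
theorem LowerBoundAt.band {δ : ℝ} (h0 : 0 < δ) (h1 : δ ≤ 1)
    (h : LowerBoundAt fun m => ⌈(m : ℝ) ^ δ⌉₊) {k : ℕ → ℕ}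
    (hk : ∀ᶠ m : ℕ in atTop, ⌈(m : ℝ) ^ δ⌉₊ ≤ k m ∧ k m + Nat.sqrt m + 1 ≤ m) : LowerBoundAt k :=
  h.of_padding (eventually_padding_of_band h0 h1 hk)

/-- **MONOTONICITY IN `δ`.** For `0 < δ' ≤ δ < 1`: hardness at `⌈m^δ'⌉₊` implies hardness at `⌈m^δ⌉₊`
over the full extended basis. [folklore] -/
theorem lowerBoundAt_rpow_mono {δ' δ : ℝ} (h0 : 0 < δ') (hle : δ' ≤ δ) (h1 : δ < 1)
    (h : LowerBoundAt fun m => ⌈(m : ℝ) ^ δ'⌉₊) : LowerBoundAt fun m => ⌈(m : ℝ) ^ δ⌉₊ :=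
  h.band h0 (hle.trans h1.le) (eventually_band_rpow hle h1)

/-- **The crux forces the lower bound at every exponent `δ ∈ [1/2, 1)`** — e.g. at the planted-clique
scale `k = ⌈√m⌉₊` and at `k = ⌈m^{0.99}⌉₊`. [folklore] -/
theorem lowerBoundAt_of_cliqueExtLowerBound (h : CliqueExtLowerBound) {δ : ℝ} (hδ : 1 / 2 ≤ δ)
    (hδ1 : δ < 1) : LowerBoundAt fun m => ⌈(m : ℝ) ^ δ⌉₊ := by
  obtain ⟨δ₀, h0, h12, hH⟩ := cliqueExtLowerBound_iff.1 h
  exact lowerBoundAt_rpow_mono h0 (by linarith) hδ1 hH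

/-- **The crux forces the lower bound on the whole band `[⌈√m⌉₊, m - Nat.sqrt m - 1]`.** [folklore] -/
theorem lowerBoundAt_band_of_cliqueExtLowerBound (h : CliqueExtLowerBound) {k : ℕ → ℕ}
    (hk : ∀ᶠ m : ℕ in atTop, ⌈(m : ℝ) ^ (1 / 2 : ℝ)⌉₊ ≤ k m ∧ k m + Nat.sqrt m + 1 ≤ m) :
    LowerBoundAt k :=
  (lowerBoundAt_of_cliqueExtLowerBound h le_rfl (by norm_num)).band (by norm_num) (by norm_num) hk

/-- **REFUTATION TARGET (band form).** A polynomial `B_{m^c}`-circuit family computing `CLIQUE(m, k m)`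
infinitely often, for ANY ONE schedule in the band `⌈√m⌉₊ ≤ k m ≤ m - Nat.sqrt m - 1`, kills the crux.
[folklore] -/
theorem not_cliqueExtLowerBound_of_not_lowerBoundAt_band {k : ℕ → ℕ}
    (hk : ∀ᶠ m : ℕ in atTop, ⌈(m : ℝ) ^ (1 / 2 : ℝ)⌉₊ ≤ k m ∧ k m + Nat.sqrt m + 1 ≤ m)
    (h : ¬ LowerBoundAt k) : ¬ CliqueExtLowerBound :=
  fun hC => h (lowerBoundAt_band_of_cliqueExtLowerBound hC hk)

/-- **Read-back, interval form**: the crux says that the lower bound holds at `⌈m^δ⌉₊` for a whole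
interval of exponents `[δ₀, 1)` with `δ₀ < 1/2` — the restriction `δ < 1/2` in the route text buys nothing
on the statement side. [folklore] -/
theorem cliqueExtLowerBound_iff_interval :
    CliqueExtLowerBound ↔ ∃ δ₀ : ℝ, 0 < δ₀ ∧ δ₀ < 1 / 2 ∧
      ∀ δ, δ₀ ≤ δ → δ < 1 → LowerBoundAt fun m => ⌈(m : ℝ) ^ δ⌉₊ := by
  rw [cliqueExtLowerBound_iff]
  constructor
  · rintro ⟨δ₀, h0, h12, hH⟩
    exact ⟨δ₀, h0, h12, fun δ hle h1 => lowerBoundAt_rpow_mono h0 hle h1 hH⟩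
  · rintro ⟨δ₀, h0, h12, hH⟩
    exact ⟨δ₀, h0, h12, hH δ₀ le_rfl (by linarith)⟩

/-- `⌈√m⌉₊ ≤ m / 2` and `m / 2 + Nat.sqrt m + 1 ≤ m` eventually. [folklore] -/
theorem eventually_sqrt_le_half :
    ∀ᶠ m : ℕ in atTop, ⌈(m : ℝ) ^ (1 / 2 : ℝ)⌉₊ ≤ m / 2 ∧ m / 2 + Nat.sqrt m + 1 ≤ m := by
  filter_upwards [eventually_two_mul_ceil_rpow_le (show (1 / 2 : ℝ) < 1 by norm_num),
    eventually_two_mul_sqrt_le] with m h h'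
  omega

/-- **Half-size cliques are hard if the crux holds**: `CliqueExtLowerBound → LowerBoundAt (m / 2)`
(`C(m, m/2)` is superpolynomial, so no single-gate kill applies; a polynomial extended circuit for
`CLIQUE(m, m/2)` infinitely often would refute the crux). [folklore] -/
theorem lowerBoundAt_half_of_cliqueExtLowerBound (h : CliqueExtLowerBound) :
    LowerBoundAt fun m => m / 2 :=
  lowerBoundAt_band_of_cliqueExtLowerBound h eventually_sqrt_le_half

/-- **Cliques missing `⌈m^ε⌉₊` vertices are hard if the crux holds** (`1/2 < ε < 1`):
`CliqueExtLowerBound → LowerBoundAt (m - ⌈m^ε⌉₊)`. Compare the REFUTED defects `m - k = O(1)`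
(`not_lowerBoundAt_sub_const`) and `m - k = Θ(log m)` (`LargeCliquesHashing.not_lowerBoundAt_sub_clog`):
polynomial defects are inside the hard band, polylogarithmic ones are outside it. [folklore] -/
theorem lowerBoundAt_sub_rpow_of_cliqueExtLowerBound (h : CliqueExtLowerBound) {ε : ℝ}
    (hε : 1 / 2 < ε) (hε1 : ε < 1) : LowerBoundAt fun m => m - ⌈(m : ℝ) ^ ε⌉₊ := by
  refine lowerBoundAt_band_of_cliqueExtLowerBound h ?_
  -- eventually `√m + 1 ≤ m^ε - ... ` : use `m^(1/2) · 4 ≤ m^ε` for large `m`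
  have hpos : 0 < ε - 1 / 2 := by linarith
  set R : ℝ := (4 : ℝ) ^ (1 / (ε - 1 / 2)) with hR
  filter_upwards [eventually_two_mul_ceil_rpow_le hε1, eventually_ge_atTop (max 16 ⌈R⌉₊)]
    with m hm2 hm
  have hm16 : 16 ≤ m := le_of_max_le_left hm
  have hmR : R ≤ m := (Nat.le_ceil R).trans (by exact_mod_cast le_of_max_le_right hm)
  have hm0 : (0 : ℝ) < m := by exact_mod_cast (show 0 < m by omega)
  -- `4 ≤ m^(ε - 1/2)`
  have h4 : (4 : ℝ) ≤ (m : ℝ) ^ (ε - 1 / 2) := by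
    calc (4 : ℝ) = R ^ (ε - 1 / 2) := by
          rw [hR, ← Real.rpow_mul (by norm_num), one_div, inv_mul_cancel₀ hpos.ne', Real.rpow_one]
      _ ≤ (m : ℝ) ^ (ε - 1 / 2) := Real.rpow_le_rpow (by positivity) hmR hpos.le
  -- hence `4 m^(1/2) ≤ m^ε`
  have hsq : 4 * (m : ℝ) ^ (1 / 2 : ℝ) ≤ (m : ℝ) ^ ε := by
    have hsplit : (m : ℝ) ^ ε = (m : ℝ) ^ (1 / 2 : ℝ) * (m : ℝ) ^ (ε - 1 / 2) := by
      rw [← Real.rpow_add hm0]; congr 1; ring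
    rw [hsplit, mul_comm]
    exact mul_le_mul_of_nonneg_left h4 (by positivity)
  -- `Nat.sqrt m ≤ m^(1/2)`
  have hsqrt : (Nat.sqrt m : ℝ) ≤ (m : ℝ) ^ (1 / 2 : ℝ) := by
    rw [← Real.sqrt_eq_rpow, Real.le_sqrt (Nat.cast_nonneg _) (Nat.cast_nonneg _)]
    exact_mod_cast Nat.sqrt_le' m
  have hceil_half : (⌈(m : ℝ) ^ (1 / 2 : ℝ)⌉₊ : ℝ) < (m : ℝ) ^ (1 / 2 : ℝ) + 1 :=
    Nat.ceil_lt_add_one (by positivity)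
  have hceil_eps : (m : ℝ) ^ ε ≤ ⌈(m : ℝ) ^ ε⌉₊ := Nat.le_ceil _
  have hone : (1 : ℝ) ≤ (m : ℝ) ^ (1 / 2 : ℝ) := Real.one_le_rpow (by exact_mod_cast (show 1 ≤ m by omega))
    (by norm_num)
  have hkε : ⌈(m : ℝ) ^ ε⌉₊ ≤ m := by
    have := ceil_rpow_le hε1.le (show 1 ≤ m by omega); exact this
  constructor
  · -- `⌈√m⌉₊ ≤ m - ⌈m^ε⌉₊` from `2 (⌈m^ε⌉₊ + 1) ≤ m` and `⌈√m⌉₊ ≤ ⌈m^ε⌉₊`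
    have hle : ⌈(m : ℝ) ^ (1 / 2 : ℝ)⌉₊ ≤ ⌈(m : ℝ) ^ ε⌉₊ :=
      Nat.ceil_mono (Real.rpow_le_rpow_of_exponent_le (by exact_mod_cast (show 1 ≤ m by omega)) hε.le)
    omega
  · -- `m - ⌈m^ε⌉₊ + Nat.sqrt m + 1 ≤ m` from `Nat.sqrt m + 1 ≤ ⌈m^ε⌉₊`
    have hreal : (Nat.sqrt m : ℝ) + 1 ≤ ⌈(m : ℝ) ^ ε⌉₊ := by linarith
    have hnat : Nat.sqrt m + 1 ≤ ⌈(m : ℝ) ^ ε⌉₊ := by exact_mod_cast hreal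
    omega

/-! ### The sibling cruxes #4 `LinAlgGateBlind` and #2 `ConvexGateBlind` (same band, same monotonicity) -/

/-- The linear-algebra family `{∧₂, ∨₂} ∪ PERM_s ∪ GRANK_s` (crux #4). [folklore] -/
theorem linFamily_monotone :
    Monotone fun s => ({GateFn.and 2, GateFn.or 2} ∪ {g | IsPermGate s g ∨ IsGRankGate s g} : Set GateFn) := by
  rintro s t hst g (hg | hg)
  · exact Or.inl hg
  · rcases hg with hg | hg
    · exact Or.inr (Or.inl (hg.mono hst))
    · exact Or.inr (Or.inr (hg.mono hst))

/-- **Crux #4 forces its lower bound on the whole band `[⌈√m⌉₊, m - Nat.sqrt m - 1]`** (constants are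
GRANK gates of dimension `0`). [folklore] -/
theorem linLowerBoundAt_band_of_linAlgGateBlind (h : LinAlgGateBlind) {k : ℕ → ℕ}
    (hk : ∀ᶠ m : ℕ in atTop, ⌈(m : ℝ) ^ (1 / 2 : ℝ)⌉₊ ≤ k m ∧ k m + Nat.sqrt m + 1 ≤ m) :
    LinLowerBoundAt k := by
  obtain ⟨δ₀, h0, h12, hH⟩ := linAlgGateBlind_iff.1 h
  have hconst : ∀ s, (⟨0, fun _ => true⟩ : GateFn) ∈
      ({GateFn.and 2, GateFn.or 2} ∪ {g | IsPermGate s g ∨ IsGRankGate s g} : Set GateFn) :=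
    fun s => Or.inr (Or.inr ((isGRankGate_constTrue 0).mono (Nat.zero_le s)))
  have hhalf : LinLowerBoundAt fun m => ⌈(m : ℝ) ^ (1 / 2 : ℝ)⌉₊ :=
    lowerBoundAtOver_rpow_mono linFamily_monotone hconst h0 (by linarith) (by norm_num) hH
  exact LowerBoundAtOver.band linFamily_monotone hconst (by norm_num) (by norm_num) hhalf hk

/-- The convex family `{∧₂, ∨₂} ∪ CONV_s` (crux #2). [folklore] -/
theorem convFamily_monotone :
    Monotone fun s => ({GateFn.and 2, GateFn.or 2} ∪ {g | IsConvGate s g} : Set GateFn) := by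
  rintro s t hst g (hg | hg)
  · exact Or.inl hg
  · exact Or.inr (IsConvGate.mono hg hst)

/-- Read-back of crux #2 `ConvexGateBlind` in schedule form over the convex family. [folklore] -/
theorem convexGateBlind_iff_over : ConvexGateBlind ↔ ∃ δ : ℝ, 0 < δ ∧ δ < 1 / 2 ∧
    LowerBoundAtOver (fun s => {GateFn.and 2, GateFn.or 2} ∪ {g | IsConvGate s g})
      (fun m => ⌈(m : ℝ) ^ δ⌉₊) :=
  Iff.rfl

/-- **Crux #2 forces its lower bound on the whole band `[⌈√m⌉₊, m - Nat.sqrt m - 1]`** (constants are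
CONV gates of width `0`; cf. the sibling seat's `cliqueHard_mono`, Cruxes/ConvexGateBlind/Disproof.lean §E,
which pads gate DATA after the single-gate collapse). [folklore] -/
theorem convLowerBoundAt_band_of_convexGateBlind (h : ConvexGateBlind) {k : ℕ → ℕ}
    (hk : ∀ᶠ m : ℕ in atTop, ⌈(m : ℝ) ^ (1 / 2 : ℝ)⌉₊ ≤ k m ∧ k m + Nat.sqrt m + 1 ≤ m) :
    LowerBoundAtOver (fun s => {GateFn.and 2, GateFn.or 2} ∪ {g | IsConvGate s g}) k := by
  obtain ⟨δ₀, h0, h12, hH⟩ := convexGateBlind_iff_over.1 h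
  have hconst : ∀ s, (⟨0, fun _ => true⟩ : GateFn) ∈
      ({GateFn.and 2, GateFn.or 2} ∪ {g | IsConvGate s g} : Set GateFn) :=
    fun s => Or.inr ((isConvGate_constTrue 0).mono (Nat.zero_le s))
  have hhalf : LowerBoundAtOver (fun s => {GateFn.and 2, GateFn.or 2} ∪ {g | IsConvGate s g})
      fun m => ⌈(m : ℝ) ^ (1 / 2 : ℝ)⌉₊ :=
    lowerBoundAtOver_rpow_mono convFamily_monotone hconst h0 (by linarith) (by norm_num) hH
  exact LowerBoundAtOver.band convFamily_monotone hconst (by norm_num) (by norm_num) hhalf hk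

end Band

end Gen3Band

/-! ## §12 (NEW, gen 3) GRANK consequences: the third width parameter is load-bearing; GRANK-only kills

Drawn from the sibling seat's landed `Theorems/LinAlgGateBlind/Negative/ValiantCertificate.lean` (ONE
GRANK gate over `ℚ` of dimension `1 + C(m,k)·#E` computes CLIQUE(m,k)): the trichotomy is complete —
EACH of CONV (§1–§2), PERM (§7) and GRANK (here) alone kills every poly-enumerable schedule and EACH width
parameter inside `Ext` is used by any proof (landing: `Negative/GRankConsequences.lean`). -/

section Gen3GRank

open Summit.PneNP.PneNP.Theorems.LinAlgGateBlind.Negative (exists_oneGRankGate_computes_cliqueFn)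

/-! ### 1. The GRANK-only sub-basis and its schedule refutations -/

/-- Lower bound at schedule `k` over the GRANK-only sub-basis `{∧₂, ∨₂} ∪ GRANK_{m^c}`. [folklore] -/
def GRankLowerBoundAt (k : ℕ → ℕ) : Prop :=
  ∀ c : ℕ, ∀ᶠ m : ℕ in atTop, ∀ C : Circuit ((⊤ : SimpleGraph (Fin m)).edgeSet),
    C.IsOver ({GateFn.and 2, GateFn.or 2} ∪ {g | IsGRankGate (m ^ c) g}) →
      C.size ≤ m ^ c → ¬ C.Computes (cliqueFn m (k m))

/-- The full basis contains the GRANK-only sub-basis: `LowerBoundAt k → GRankLowerBoundAt k`. [folklore] -/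
theorem gRankLowerBoundAt_of_lowerBoundAt {k : ℕ → ℕ} (h : LowerBoundAt k) : GRankLowerBoundAt k := by
  intro c
  filter_upwards [h c] with m hm C hC hs
  refine hm C (hC.mono ?_) hs
  rintro g (hg | hg)
  · exact monotoneBasis_subset_extGate _ hg
  · exact IsGRankGate.mem_extGate hg

/-- Width bookkeeping: `1 + C(m,k)·#E(K_m) ≤ m^{j+3}` once `C(m,k) ≤ m^j` and `m ≥ 2`. [folklore] -/
theorem grankWidth_le_of_choose_le (m k j : ℕ) (hm : 2 ≤ m) (hq : m.choose k ≤ m ^ j) :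
    1 + m.choose k * nE m ≤ m ^ (j + 3) := by
  have h1 : m.choose k * nE m ≤ m ^ (j + 2) :=
    calc m.choose k * nE m ≤ m ^ j * m ^ 2 := Nat.mul_le_mul hq (nE_le m)
      _ = m ^ (j + 2) := by rw [← pow_add]
  have h2 : 1 ≤ m ^ (j + 2) := Nat.one_le_pow _ _ (by omega)
  calc 1 + m.choose k * nE m ≤ m ^ (j + 2) + m ^ (j + 2) := add_le_add h2 h1
    _ = 2 * m ^ (j + 2) := by ring
    _ ≤ m * m ^ (j + 2) := Nat.mul_le_mul_right _ hm
    _ = m ^ (j + 3) := by ring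

/-- **One GRANK gate kills every polynomially-enumerable schedule over the GRANK-only sub-basis**: if
`C(m, k m) ≤ m^j` and `k m ≥ 2` eventually, then `GRankLowerBoundAt k` is false (at `c = j + 3` the
size-1 circuit of `exists_oneGRankGate_computes_cliqueFn` has dimension `≤ m^{j+3}`). [folklore] -/
theorem not_gRankLowerBoundAt_of_choose_le {k : ℕ → ℕ} {j : ℕ} (h2 : ∀ᶠ m : ℕ in atTop, 2 ≤ k m)
    (h : ∀ᶠ m : ℕ in atTop, m.choose (k m) ≤ m ^ j) : ¬ GRankLowerBoundAt k := by
  intro hLB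
  obtain ⟨m, hm, hk, hch, h2m⟩ := ((hLB (j + 3)).and (h2.and (h.and (eventually_ge_atTop 2)))).exists
  obtain ⟨C, hC, hs, hc⟩ := exists_oneGRankGate_computes_cliqueFn m (k m) hk
  refine hm C (hC.mono ?_) (hs.trans (Nat.one_le_pow _ _ (by omega))) hc
  intro g hg
  exact Or.inr (IsGRankGate.mono hg (grankWidth_le_of_choose_le m (k m) j h2m hch))

/-- Constant `k ≥ 2` over the GRANK-only sub-basis: false. [folklore] -/
theorem not_gRankLowerBoundAt_const {k : ℕ} (hk : 2 ≤ k) : ¬ GRankLowerBoundAt fun _ => k :=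
  not_gRankLowerBoundAt_of_choose_le (j := k) (Eventually.of_forall fun _ => hk)
    (Eventually.of_forall fun m => Nat.choose_le_pow m k)

/-- `k = m - t` over the GRANK-only sub-basis: false. [folklore] -/
theorem not_gRankLowerBoundAt_sub_const (t : ℕ) : ¬ GRankLowerBoundAt fun m => m - t := by
  refine not_gRankLowerBoundAt_of_choose_le (j := t) ?_ ?_
  · filter_upwards [eventually_ge_atTop (t + 2)] with m hm
    omega
  · filter_upwards [eventually_ge_atTop t] with m hm
    rw [Nat.choose_symm hm]
    exact Nat.choose_le_pow m t

/-! ### 2. The GRANK dimension bound is load-bearing for the crux -/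

/-- **Any proof must use the GRANK dimension bound**: the crux with `d ≤ s` dropped in the GRANK
disjunct (GRANK gates of ANY dimension; everything else as filed) is false already at `c = 0` — ONE GRANK
gate over `ℚ` (the Valiant path-block matrix of the clique polynomial) computes `CLIQUE(m, ⌈m^δ⌉₊)`.
[folklore] -/
theorem cliqueExtLowerBound_false_without_grankDim :
    ¬ ∃ δ : ℝ, 0 < δ ∧ δ < 1 / 2 ∧ ∀ c : ℕ, ∀ᶠ m : ℕ in atTop,
      ∀ C : Circuit ((⊤ : SimpleGraph (Fin m)).edgeSet),
        C.IsOver ({GateFn.and 2, GateFn.or 2} ∪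
          {g | IsConvGate (m ^ c) g ∨ IsPermGate (m ^ c) g ∨ ∃ w, IsGRankGate w g}) →
        C.size ≤ m ^ c → ¬ C.Computes (cliqueFn m ⌈(m : ℝ) ^ δ⌉₊) := by
  rintro ⟨δ, hδ0, -, h⟩
  obtain ⟨m, hm, h2⟩ := ((h 0).and (eventually_ge_atTop 2)).exists
  obtain ⟨C, hC, hs, hc⟩ := exists_oneGRankGate_computes_cliqueFn m ⌈(m : ℝ) ^ δ⌉₊
    (two_le_ceil_rpow hδ0 h2)
  refine hm C (hC.mono fun g hg => Or.inr (Or.inr (Or.inr ⟨_, hg⟩))) ?_ hc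
  simpa using hs

/-! ### 3. Sanity implication: the crux in single-GRANK-gate language -/

/-- **The crux implies that the GRANK door alone is blind**: if `CliqueExtLowerBound` holds with exponent
`δ`, then for every `c`, eventually in `m`, NO single GRANK gate of dimension `≤ m^c` — any field, any
number `n` of inputs, input `i` reading the edge `w i` — computes `CLIQUE(m, ⌈m^δ⌉₊)` (it would be a
size-1 circuit over `B_{m^c}`). By the sibling file `ValiantCertificate.lean` this consequence is already
Valiant-hard (a superpolynomial determinantal-complexity bound for an explicit family over every field);
it is recorded so that a refutation of THIS consequence would refute the crux. [folklore] -/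
theorem grank_dim_lower_bound_of_cliqueExtLowerBound (h : CliqueExtLowerBound) :
    ∃ δ : ℝ, 0 < δ ∧ δ < 1 / 2 ∧ ∀ c : ℕ, ∀ᶠ m : ℕ in atTop,
      ∀ (n : ℕ) (f : (Fin n → Bool) → Bool) (w : Fin n → (⊤ : SimpleGraph (Fin m)).edgeSet),
        IsGRankGate (m ^ c) ⟨n, f⟩ →
        ¬ ∀ x : (⊤ : SimpleGraph (Fin m)).edgeSet → Bool,
          f (fun i => x (w i)) = cliqueFn m ⌈(m : ℝ) ^ δ⌉₊ x := by
  classical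
  obtain ⟨δ, hδ0, hδ1, hLB⟩ := cliqueExtLowerBound_iff.1 h
  refine ⟨δ, hδ0, hδ1, fun c => ?_⟩
  filter_upwards [hLB c, eventually_ge_atTop 1] with m hm h1 n f w hgate hcomp
  obtain ⟨C, hC, hs, he⟩ := (CktSize.gate (B := extGate (m ^ c)) ⟨n, f⟩ hgate.mem_extGate w).toCircuit
  refine hm C hC (hs.trans (Nat.one_le_pow _ _ h1)) fun x => ?_
  rw [he x]
  exact hcomp x

end Gen3GRank

/-! ## §14 (NEW, gen 3) The CONV door needs MANY ROWS: few constraint rows cannot compute CLIQUE, whatever the psd dimension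

A single CONV gate reads its input through `p` non-negative linear measurements `(B 𝟙_x)_i` and tests
membership of `b + B 𝟙_x` in a FIXED convex up-closed set of `ℝ^p` (a spectrahedral shadow of any dimension `q`,
any real data). If it computes CLIQUE(m,k), every colouring is rejected with a STRICT Farkas certificate (free
trace normalisation; provers' `Certificates.lean`), whose HEAVY SET is a sign pattern of `#E·C(m,k)` linear
functionals on `ℝ^p` — at most `(#E·C(m,k)+1)^p` patterns (regions of a central arrangement,
`card_signPatterns_le`) — and per heavy set few colourings are rejected (provers' matching count). Hence
`(k−1)^m ≤ (m^{k+3})^p · k² m^{k²} (k−1)^{(m+k)/2+k²}`, i.e. at `δ = 1/4` a one-gate CONV kill needs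
`p ≳ m^{3/4}/16` ROWS (`cliqueExtLowerBound_convFewRows_corner`), complementing the provers' `q ≳ m^{3/8}`
(SdpFewDimsCorner) and LP `q ≳ m/(64(c+2))` (LinearVariables) corners. The "O(1) wild real constraints"
loophole is closed. (Landing: `Negative/SignPatterns.lean`, `FewRowsCount.lean`, `FewRows.lean`.) -/

section Gen3FewRows

open Module
open Summit.PneNP.PneNP.Theorems (exists_disjoint_heavy_edges card_colorings_sum_lt_le_of_disjoint
  conv_exists_traceBound certificate_of_infeasible_traceBounded sym2_exists_eq_mk
  eventually_threshold_corner_conditions)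

section SignPatterns

variable {V : Type*} [AddCommGroup V] [Module ℝ V]

open Classical in
/-- The realisable sign patterns `(decide (0 ≤ gⱼ y))ⱼ` of a tuple of linear functionals. [folklore] -/
noncomputable def signPatterns {N : ℕ} (g : Fin N → V →ₗ[ℝ] ℝ) : Finset (Fin N → Bool) :=
  univ.filter fun σ => ∃ y : V, ∀ j, σ j = decide (0 ≤ g j y)

open Classical in
/-- Membership in `signPatterns`. [folklore] -/
theorem mem_signPatterns {N : ℕ} (g : Fin N → V →ₗ[ℝ] ℝ) (σ : Fin N → Bool) :
    σ ∈ signPatterns g ↔ ∃ y : V, ∀ j, σ j = decide (0 ≤ g j y) := by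
  simp [signPatterns]

/-- **Region count for central arrangements.** `N` linear functionals on a real vector space of
dimension `d` realise at most `(N+1)^d` sign patterns. [folklore] -/
theorem card_signPatterns_le [FiniteDimensional ℝ V] :
    ∀ (N : ℕ) (g : Fin N → V →ₗ[ℝ] ℝ), #(signPatterns g) ≤ (N + 1) ^ finrank ℝ V := by
  classical
  intro N
  induction N generalizing V with
  | zero =>
    intro g
    calc #(signPatterns g) ≤ #(univ : Finset (Fin 0 → Bool)) := card_le_univ _
      _ = 1 := by simp
      _ = (0 + 1) ^ finrank ℝ V := by simp
  | succ N ih =>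
    intro g
    set g' : Fin N → V →ₗ[ℝ] ℝ := fun j => g (Fin.castSucc j) with hg'
    set gl : V →ₗ[ℝ] ℝ := g (Fin.last N) with hgl
    -- restriction of patterns
    set ρ : (Fin (N + 1) → Bool) → (Fin N → Bool) := fun σ j => σ (Fin.castSucc j) with hρ
    set P := signPatterns g with hP
    set P₁ := P.filter fun σ => σ (Fin.last N) = true with hP₁
    set P₀ := P.filter fun σ => σ (Fin.last N) = false with hP₀
    have hsplit : #P = #P₁ + #P₀ := by
      rw [hP₁, hP₀, ← Finset.card_filter_add_card_filter_not (fun σ => σ (Fin.last N) = true)]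
      congr 2
      ext σ
      simp
    -- `ρ` is injective on each half
    have hinj : ∀ b : Bool, Set.InjOn ρ ↑(P.filter fun σ => σ (Fin.last N) = b) := by
      intro b σ hσ τ hτ hστ
      rw [Finset.coe_filter] at hσ hτ
      funext j
      rcases Fin.eq_castSucc_or_eq_last j with ⟨j', rfl⟩ | rfl
      · exact congrFun hστ j'
      · rw [hσ.2, hτ.2]
    -- images lie in the patterns of `g'`
    have himg : ∀ b : Bool, (P.filter fun σ => σ (Fin.last N) = b).image ρ ⊆ signPatterns g' := by
      intro b τ hτ
      obtain ⟨σ, hσ, rfl⟩ := Finset.mem_image.1 hτ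
      obtain ⟨y, hy⟩ := (mem_signPatterns g σ).1 (Finset.mem_filter.1 hσ).1
      exact (mem_signPatterns g' _).2 ⟨y, fun j => hy (Fin.castSucc j)⟩
    -- the doubly-extendable patterns are realised on the hyperplane `ker gl`
    set H := LinearMap.ker gl with hH
    set gH : Fin N → H →ₗ[ℝ] ℝ := fun j => (g' j).comp H.subtype with hgH
    have hboth : (P₁.image ρ ∩ P₀.image ρ) ⊆ signPatterns gH := by
      intro τ hτ
      rw [Finset.mem_inter] at hτ
      obtain ⟨σ₁, hσ₁, h₁⟩ := Finset.mem_image.1 hτ.1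
      obtain ⟨σ₀, hσ₀, h₀⟩ := Finset.mem_image.1 hτ.2
      obtain ⟨hσ₁P, hσ₁l⟩ := Finset.mem_filter.1 hσ₁
      obtain ⟨hσ₀P, hσ₀l⟩ := Finset.mem_filter.1 hσ₀
      obtain ⟨y₁, hy₁⟩ := (mem_signPatterns g σ₁).1 hσ₁P
      obtain ⟨y₀, hy₀⟩ := (mem_signPatterns g σ₀).1 hσ₀P
      have ha : 0 ≤ gl y₁ := by
        have := hy₁ (Fin.last N); rw [hσ₁l] at this
        exact of_decide_eq_true this.symm
      have hb : gl y₀ < 0 := by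
        have := hy₀ (Fin.last N); rw [hσ₀l] at this
        exact not_le.1 (of_decide_eq_false this.symm)
      set a := gl y₁ with ha'
      set b := - gl y₀ with hb'
      have hb0 : 0 < b := by rw [hb']; linarith
      have hab : 0 < a + b := by linarith
      set z : V := (b / (a + b)) • y₁ + (a / (a + b)) • y₀ with hz
      have hzH : z ∈ H := by
        rw [hH, LinearMap.mem_ker, hz, map_add, map_smul, map_smul, smul_eq_mul, smul_eq_mul]
        rw [← ha', show gl y₀ = -b by rw [hb']; ring]
        field_simp
        ring
      refine (mem_signPatterns gH τ).2 ⟨⟨z, hzH⟩, fun j => ?_⟩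
      have hj₁ : τ j = decide (0 ≤ g' j y₁) := by rw [← h₁]; exact hy₁ (Fin.castSucc j)
      have hj₀ : τ j = decide (0 ≤ g' j y₀) := by rw [← h₀]; exact hy₀ (Fin.castSucc j)
      have hval : gH j ⟨z, hzH⟩ = (b / (a + b)) * g' j y₁ + (a / (a + b)) * g' j y₀ := by
        simp [hgH, hz]
      have hc1 : 0 < b / (a + b) := div_pos hb0 hab
      have hc0 : 0 ≤ a / (a + b) := div_nonneg ha hab.le
      rw [hval]
      cases hτj : τ j
      · rw [hτj] at hj₁ hj₀
        have h1 : g' j y₁ < 0 := not_le.1 (of_decide_eq_false hj₁.symm)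
        have h0 : g' j y₀ < 0 := not_le.1 (of_decide_eq_false hj₀.symm)
        symm
        rw [decide_eq_false_iff_not, not_le]
        have : a / (a + b) * g' j y₀ ≤ 0 := mul_nonpos_of_nonneg_of_nonpos hc0 h0.le
        nlinarith
      · rw [hτj] at hj₁ hj₀
        have h1 : 0 ≤ g' j y₁ := of_decide_eq_true hj₁.symm
        have h0 : 0 ≤ g' j y₀ := of_decide_eq_true hj₀.symm
        symm
        rw [decide_eq_true_iff]
        positivity
    -- counting
    have hcard : #P ≤ #(signPatterns g') + #(signPatterns gH) := by
      rw [hsplit, ← Finset.card_image_of_injOn (hinj true), ← Finset.card_image_of_injOn (hinj false),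
        ← Finset.card_union_add_card_inter]
      exact Nat.add_le_add (Finset.card_le_card (Finset.union_subset (himg true) (himg false)))
        (Finset.card_le_card hboth)
    have ih1 := ih g'
    by_cases hgl0 : gl = 0
    · -- only one extension: the intersection is empty, as no pattern has `false` last
      have hP₀e : P₀ = ∅ := by
        rw [hP₀, Finset.filter_eq_empty_iff]
        intro σ hσ hl
        obtain ⟨y, hy⟩ := (mem_signPatterns g σ).1 hσ
        have := hy (Fin.last N)
        rw [hl, ← hgl, hgl0] at this
        simp at this
      have : #P ≤ #(signPatterns g') := by
        rw [hsplit, hP₀e, Finset.card_empty, add_zero, ← Finset.card_image_of_injOn (hinj true)]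
        exact Finset.card_le_card (himg true)
      calc #P ≤ (N + 1) ^ finrank ℝ V := this.trans ih1
        _ ≤ (N + 1 + 1) ^ finrank ℝ V := Nat.pow_le_pow_left (by omega) _
    · -- `dim ker gl = d - 1`
      have hrange : finrank ℝ (LinearMap.range gl) = 1 := by
        have h1 : finrank ℝ (LinearMap.range gl) ≤ 1 :=
          (Submodule.finrank_le _).trans (by simp)
        have h2 : 0 < finrank ℝ (LinearMap.range gl) := by
          rw [Module.finrank_pos_iff_exists_ne_zero]
          obtain ⟨v, hv⟩ : ∃ v, gl v ≠ 0 := by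
            by_contra h
            push Not at h
            exact hgl0 (LinearMap.ext h)
          exact ⟨⟨gl v, LinearMap.mem_range_self gl v⟩, fun h => hv (congrArg Subtype.val h)⟩
        omega
      have hdim : finrank ℝ H + 1 = finrank ℝ V := by
        have := LinearMap.finrank_range_add_finrank_ker gl
        rw [hrange] at this
        rw [hH]; omega
      have ihH := ih gH
      set d := finrank ℝ V with hd
      have hd1 : finrank ℝ H = d - 1 := by omega
      have hdpos : 1 ≤ d := by omega
      -- `(x+1)^(n+1) ≥ x^(n+1) + x^n`
      have key : ∀ x n : ℕ, x ^ (n + 1) + x ^ n ≤ (x + 1) ^ (n + 1) := by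
        intro x n
        rw [pow_succ, pow_succ]
        have hx : x ^ n ≤ (x + 1) ^ n := Nat.pow_le_pow_left (by omega) _
        nlinarith
      calc #P ≤ (N + 1) ^ d + (N + 1) ^ (d - 1) := by
            rw [hd1] at ihH; exact hcard.trans (Nat.add_le_add ih1 ihH)
        _ = (N + 1) ^ (d - 1 + 1) + (N + 1) ^ (d - 1) := by rw [Nat.sub_add_cancel hdpos]
        _ ≤ (N + 1 + 1) ^ (d - 1 + 1) := key (N + 1) (d - 1)
        _ = (N + 1 + 1) ^ d := by rw [Nat.sub_add_cancel hdpos]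

open Classical in
/-- Realisable sign patterns of a finite family of linear functionals (arbitrary finite index type).
[folklore] -/
noncomputable def signPatterns' {ι : Type*} [Fintype ι] (g : ι → V →ₗ[ℝ] ℝ) : Finset (ι → Bool) :=
  univ.filter fun σ => ∃ y : V, ∀ i, σ i = decide (0 ≤ g i y)

open Classical in
/-- Membership in `signPatterns'`. [folklore] -/
theorem mem_signPatterns' {ι : Type*} [Fintype ι] (g : ι → V →ₗ[ℝ] ℝ) (σ : ι → Bool) :
    σ ∈ signPatterns' g ↔ ∃ y : V, ∀ i, σ i = decide (0 ≤ g i y) := by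
  simp [signPatterns']

/-- **Region count, arbitrary finite index type**: at most `(#ι + 1)^d` sign patterns. [folklore] -/
theorem card_signPatterns_le' [FiniteDimensional ℝ V] {ι : Type*} [Fintype ι] (g : ι → V →ₗ[ℝ] ℝ) :
    #(signPatterns' g) ≤ (Fintype.card ι + 1) ^ finrank ℝ V := by
  classical
  set e := Fintype.equivFin ι with he
  set g₀ : Fin (Fintype.card ι) → V →ₗ[ℝ] ℝ := fun j => g (e.symm j) with hg₀
  have hmap : (signPatterns' g).image (fun σ : ι → Bool => fun j => σ (e.symm j)) ⊆ signPatterns g₀ := by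
    intro τ hτ
    obtain ⟨σ, hσ, rfl⟩ := Finset.mem_image.1 hτ
    obtain ⟨y, hy⟩ := (mem_signPatterns' g σ).1 hσ
    exact (mem_signPatterns g₀ _).2 ⟨y, fun j => hy (e.symm j)⟩
  have hinj : Set.InjOn (fun σ : ι → Bool => fun j => σ (e.symm j)) ↑(signPatterns' g) := by
    intro σ _ τ _ hστ
    funext i
    have := congrFun hστ (e i)
    simpa using this
  calc #(signPatterns' g) = #((signPatterns' g).image fun σ : ι → Bool => fun j => σ (e.symm j)) :=
        (Finset.card_image_of_injOn hinj).symm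
    _ ≤ #(signPatterns g₀) := Finset.card_le_card hmap
    _ ≤ (Fintype.card ι + 1) ^ finrank ℝ V := card_signPatterns_le _ g₀

end SignPatterns

/-- The linear functional `y ↦ ∑ᵢ yᵢ cᵢ` on `ℝ^p`. [folklore] -/
def dotLin {p : ℕ} (c : Fin p → ℝ) : (Fin p → ℝ) →ₗ[ℝ] ℝ where
  toFun y := ∑ i, y i * c i
  map_add' y z := by simp [Finset.sum_add_distrib, add_mul]
  map_smul' a y := by simp [Finset.mul_sum, mul_assoc]

@[simp] theorem dotLin_apply {p : ℕ} (c : Fin p → ℝ) (y : Fin p → ℝ) :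
    dotLin c y = ∑ i, y i * c i := rfl

/-- **Few certificate directions reject few colourings.** See the module docstring. [folklore] -/
theorem pow_le_of_strictCertificates {m k p : ℕ} (hk : 2 ≤ k) (hkm : k ≤ m)
    (B' : Fin p → (⊤ : SimpleGraph (Fin m)).edgeSet → ℝ) (hB' : ∀ i e, 0 ≤ B' i e)
    (hcert : ∀ h : Fin m → Fin (k - 1), ∃ y : Fin p → ℝ, (∀ i, 0 ≤ y i) ∧
      ∀ S : Finset (Fin m), S.card = k →
        (∑ e, if colorVec h e = true then (∑ i, y i * B' i e) else 0) <
          ∑ e, if cliqueVec S e = true then (∑ i, y i * B' i e) else 0) :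
    (k - 1) ^ m ≤
      (Fintype.card ((⊤ : SimpleGraph (Fin m)).edgeSet × {S : Finset (Fin m) // S.card = k}) + 1) ^ p *
        (k ^ 2 * m ^ (k ^ 2) * (k - 1) ^ ((m + k) / 2 + k ^ 2)) := by
  classical
  -- notation
  choose y hy0 hyS using hcert
  set β : (Fin p → ℝ) → (⊤ : SimpleGraph (Fin m)).edgeSet → ℝ := fun z e => ∑ i, z i * B' i e with hβ
  have hβ0 : ∀ z : Fin p → ℝ, (∀ i, 0 ≤ z i) → ∀ e, 0 ≤ β z e := fun z hz e =>
    Finset.sum_nonneg fun i _ => mul_nonneg (hz i) (hB' i e)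
  set kSets : Finset (Finset (Fin m)) := Finset.powersetCard k univ with hkSets
  have hkmem : ∀ S, S ∈ kSets ↔ S.card = k := fun S => by simp [hkSets, Finset.mem_powersetCard]
  have hkne : kSets.Nonempty := Finset.powersetCard_nonempty.2 (by simpa using hkm)
  set cw : (Fin p → ℝ) → Finset (Fin m) → ℝ :=
    fun z S => ∑ e, if cliqueVec S e = true then β z e else 0 with hcw
  set colw : (Fin p → ℝ) → (Fin m → Fin (k - 1)) → ℝ :=
    fun z h => ∑ e, if colorVec h e = true then β z e else 0 with hcolw
  set θ : (Fin p → ℝ) → ℝ := fun z => kSets.inf' hkne (cw z) with hθ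
  have hθle : ∀ z S, S.card = k → θ z ≤ cw z S := fun z S hS => Finset.inf'_le _ ((hkmem S).2 hS)
  have hθpos : ∀ h, colw (y h) h < θ (y h) := by
    intro h
    obtain ⟨S₀, hS₀, hmin⟩ := Finset.exists_mem_eq_inf' hkne (cw (y h))
    rw [hθ]; dsimp only; rw [hmin]
    exact hyS h S₀ ((hkmem S₀).1 hS₀)
  have hcolw0 : ∀ h, 0 ≤ colw (y h) h := fun h =>
    Finset.sum_nonneg fun e _ => by split_ifs <;> [exact hβ0 _ (hy0 h) e; exact le_rfl]
  have hθpos' : ∀ h, 0 < θ (y h) := fun h => (hcolw0 h).trans_lt (hθpos h)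
  -- heavy sets
  set heavy : (Fin p → ℝ) → Finset (⊤ : SimpleGraph (Fin m)).edgeSet := fun z =>
    univ.filter fun e => θ z ≤ (k : ℝ) ^ 2 * β z e with hheavy
  have hk2pos : (0 : ℝ) < (k : ℝ) ^ 2 := by positivity
  -- heavy sets are determined by sign patterns of linear functionals
  set ι := (⊤ : SimpleGraph (Fin m)).edgeSet × {S : Finset (Fin m) // S.card = k}
  set g : ι → (Fin p → ℝ) →ₗ[ℝ] ℝ := fun es =>
    dotLin fun i => (k : ℝ) ^ 2 * B' i es.1 - ∑ e', if cliqueVec es.2.1 e' = true then B' i e' else 0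
    with hg
  have hgval : ∀ (es : ι) (z : Fin p → ℝ), g es z = (k : ℝ) ^ 2 * β z es.1 - cw z es.2.1 := by
    intro es z
    rw [hg]; dsimp only; rw [dotLin_apply]
    simp only [mul_sub, Finset.sum_sub_distrib]
    congr 1
    · rw [hβ]; dsimp only; rw [Finset.mul_sum]
      exact Finset.sum_congr rfl fun i _ => by ring
    · rw [hcw]; dsimp only
      simp_rw [Finset.mul_sum]
      rw [Finset.sum_comm]
      refine Finset.sum_congr rfl fun e _ => ?_
      split_ifs with he
      · rw [hβ]
      · simp
  set F : (ι → Bool) → Finset (⊤ : SimpleGraph (Fin m)).edgeSet := fun τ => univ.filter fun e => ∃ S : {S : Finset (Fin m) // S.card = k},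
    τ (e, S) = true with hF
  have hheavyF : ∀ z, heavy z = F (fun es => decide (0 ≤ g es z)) := by
    intro z
    ext e
    simp only [hheavy, hF, Finset.mem_filter, Finset.mem_univ, true_and, decide_eq_true_eq, hgval,
      sub_nonneg]
    rw [hθ]; dsimp only
    rw [Finset.inf'_le_iff]
    constructor
    · rintro ⟨S, hS, hle⟩
      exact ⟨⟨S, (hkmem S).1 hS⟩, hle⟩
    · rintro ⟨S, hle⟩
      exact ⟨S.1, (hkmem S.1).2 S.2, hle⟩
  -- the classes
  set 𝒜 : Finset (Finset (⊤ : SimpleGraph (Fin m)).edgeSet) := univ.image fun h => heavy (y h) with h𝒜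
  have h𝒜card : #𝒜 ≤ (Fintype.card ι + 1) ^ p := by
    have hsub : 𝒜 ⊆ (signPatterns' g).image F := by
      intro A hA
      obtain ⟨h, -, rfl⟩ := Finset.mem_image.1 hA
      refine Finset.mem_image.2 ⟨fun es => decide (0 ≤ g es (y h)), ?_, (hheavyF _).symm⟩
      exact (mem_signPatterns' g _).2 ⟨y h, fun _ => rfl⟩
    calc #𝒜 ≤ #((signPatterns' g).image F) := Finset.card_le_card hsub
      _ ≤ #(signPatterns' g) := Finset.card_image_le
      _ ≤ (Fintype.card ι + 1) ^ finrank ℝ (Fin p → ℝ) := card_signPatterns_le' g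
      _ = (Fintype.card ι + 1) ^ p := by rw [Module.finrank_fin_fun]
  -- per-class bound
  set r := (m - k) / 2 + 1 with hr
  have h2r : 2 * r + k ≤ m + 2 := by omega
  set K := k ^ 2 * (r + 1) ^ (k ^ 2) * (k - 1) ^ (m - r + k ^ 2) with hK
  have hclass : ∀ A ∈ 𝒜, #(univ.filter fun h => heavy (y h) = A) ≤ K := by
    intro A hA
    obtain ⟨h₀, -, rfl⟩ := Finset.mem_image.1 hA
    set z₀ := y h₀ with hz₀
    obtain ⟨f, hdisj, hfw⟩ := exists_disjoint_heavy_edges (β z₀) (hθpos' h₀)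
      (fun Q hQ => hθle z₀ Q hQ) r h2r
    -- family edges are heavy for `z₀`
    have hfA : ∀ i, f i ∈ heavy z₀ := by
      intro i
      simp only [hheavy, Finset.mem_filter, Finset.mem_univ, true_and]
      have := hfw i
      rw [div_le_iff₀ hk2pos] at this
      linarith
    -- family edges are pairwise distinct
    have f_inj : Function.Injective f := by
      intro i j hij
      by_contra hne
      obtain ⟨a, ha⟩ : ∃ a, a ∈ (f i : Sym2 (Fin m)) := by
        obtain ⟨a, b, hab⟩ := Summit.PneNP.PneNP.Theorems.sym2_exists_eq_mk (f i : Sym2 (Fin m))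
        exact ⟨a, by rw [hab]; exact Sym2.mem_mk_left a b⟩
      exact hdisj i j hne a ha (by rw [← hij]; exact ha)
    -- indicator weights of the family
    set w₁ : (⊤ : SimpleGraph (Fin m)).edgeSet → ℝ := fun e => if ∃ i, f i = e then 1 else 0 with hw₁
    have hw₁0 : ∀ e, 0 ≤ w₁ e := fun e => by rw [hw₁]; dsimp only; split_ifs <;> norm_num
    have hfw₁ : ∀ i, ((k : ℝ) ^ 2) / (k : ℝ) ^ 2 ≤ w₁ (f i) := fun i => by
      rw [div_self hk2pos.ne', hw₁]; dsimp only; rw [if_pos ⟨i, rfl⟩]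
    have hbound := card_colorings_sum_lt_le_of_disjoint hk w₁ hw₁0 hk2pos f hdisj hfw₁
    refine le_trans (Finset.card_le_card fun h hh => ?_) hbound
    rw [Finset.mem_filter] at hh ⊢
    refine ⟨Finset.mem_univ _, ?_⟩
    have hhA : heavy (y h) = heavy z₀ := hh.2
    -- fewer than `k²` family edges are bichromatic under `h`
    set z := y h with hz
    have hheavy_i : ∀ i, θ z ≤ (k : ℝ) ^ 2 * β z (f i) := by
      intro i
      have : f i ∈ heavy z := by rw [hhA]; exact hfA i
      simpa [hheavy] using this
    -- the indicator sum equals the number of bichromatic family edges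
    set T : Finset (Fin r) := univ.filter fun i => colorVec h (f i) = true with hT
    have hsum_ind : (∑ e, if colorVec h e = true then w₁ e else 0) = (T.card : ℝ) := by
      have h1 : ∀ e, (if colorVec h e = true then w₁ e else 0) =
          ∑ i, if f i = e ∧ colorVec h (f i) = true then (1 : ℝ) else 0 := by
        intro e
        by_cases he : ∃ i, f i = e
        · obtain ⟨i, rfl⟩ := he
          rw [Finset.sum_eq_single i]
          · simp [hw₁]
          · intro j _ hji
            rw [if_neg]
            rintro ⟨hji', -⟩
            exact hji (f_inj hji')
          · simp
        · have : w₁ e = 0 := by rw [hw₁]; dsimp only; rw [if_neg he]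
          rw [this]
          simp only [ite_self]
          symm
          refine Finset.sum_eq_zero fun i _ => ?_
          rw [if_neg]
          rintro ⟨hie, -⟩
          exact he ⟨i, hie⟩
      simp_rw [h1]
      rw [Finset.sum_comm]
      have h2 : ∀ i : Fin r, (∑ e, if f i = e ∧ colorVec h (f i) = true then (1 : ℝ) else 0) =
          if colorVec h (f i) = true then 1 else 0 := by
        intro i
        rw [Finset.sum_eq_single (f i)]
        · simp
        · intro e _ hne
          rw [if_neg]
          rintro ⟨he, -⟩
          exact hne he.symm
        · simp
      simp_rw [h2]
      rw [hT, Finset.card_filter]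
      push_cast
      rfl
    -- weight of the bichromatic family edges is at most the colouring weight
    have hle_colw : (T.card : ℝ) * (θ z / (k : ℝ) ^ 2) ≤ colw z h := by
      have h1 : (T.card : ℝ) * (θ z / (k : ℝ) ^ 2) ≤ ∑ i ∈ T, β z (f i) := by
        rw [← nsmul_eq_mul, ← Finset.sum_const]
        -- wrong direction of sum_const; redo via sum_le_sum
        rw [Finset.sum_const, nsmul_eq_mul]
        calc (T.card : ℝ) * (θ z / (k : ℝ) ^ 2) = ∑ i ∈ T, θ z / (k : ℝ) ^ 2 := by
              rw [Finset.sum_const, nsmul_eq_mul]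
          _ ≤ ∑ i ∈ T, β z (f i) := Finset.sum_le_sum fun i _ => by
              rw [div_le_iff₀ hk2pos]; linarith [hheavy_i i]
      have h2 : ∑ i ∈ T, β z (f i) = ∑ e ∈ T.image f, β z e := by
        rw [Finset.sum_image fun i _ j _ hij => f_inj hij]
      have h3 : ∑ e ∈ T.image f, β z e ≤ colw z h := by
        rw [hcolw]; dsimp only
        rw [← Finset.sum_filter]
        refine Finset.sum_le_sum_of_subset_of_nonneg ?_ fun e _ _ => hβ0 z (hy0 h) e
        intro e he
        obtain ⟨i, hi, rfl⟩ := Finset.mem_image.1 he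
        exact Finset.mem_filter.2 ⟨Finset.mem_univ _, (Finset.mem_filter.1 hi).2⟩
      linarith
    have hlt : (T.card : ℝ) * (θ z / (k : ℝ) ^ 2) < θ z := hle_colw.trans_lt (hθpos h)
    have hTk : (T.card : ℝ) < (k : ℝ) ^ 2 := by
      have hθk : 0 < θ z / (k : ℝ) ^ 2 := div_pos (hθpos' h) hk2pos
      by_contra hge
      push Not at hge
      have : θ z ≤ (T.card : ℝ) * (θ z / (k : ℝ) ^ 2) := by
        calc θ z = (k : ℝ) ^ 2 * (θ z / (k : ℝ) ^ 2) := by field_simp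
          _ ≤ (T.card : ℝ) * (θ z / (k : ℝ) ^ 2) := mul_le_mul_of_nonneg_right hge hθk.le
      linarith
    rw [hsum_ind]
    exact hTk
  -- assemble
  have htotal : (k - 1) ^ m = ∑ A ∈ 𝒜, #(univ.filter fun h : Fin m → Fin (k - 1) => heavy (y h) = A) := by
    rw [h𝒜, ← Finset.card_eq_sum_card_image]
    simp
  have hK' : K ≤ k ^ 2 * m ^ (k ^ 2) * (k - 1) ^ ((m + k) / 2 + k ^ 2) := by
    have hk1 : 0 < k - 1 := by omega
    have hr1 : r + 1 ≤ m := by omega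
    have hexp : m - r + k ^ 2 ≤ (m + k) / 2 + k ^ 2 := by omega
    exact Nat.mul_le_mul (Nat.mul_le_mul_left _ (Nat.pow_le_pow_left hr1 _))
      (Nat.pow_le_pow_right hk1 hexp)
  calc (k - 1) ^ m = ∑ A ∈ 𝒜, #(univ.filter fun h : Fin m → Fin (k - 1) => heavy (y h) = A) := htotal
    _ ≤ ∑ A ∈ 𝒜, K := Finset.sum_le_sum hclass
    _ = #𝒜 * K := by rw [Finset.sum_const, smul_eq_mul]
    _ ≤ (Fintype.card ι + 1) ^ p * (k ^ 2 * m ^ (k ^ 2) * (k - 1) ^ ((m + k) / 2 + k ^ 2)) :=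
        Nat.mul_le_mul h𝒜card hK'

/-! ### The data form: strict certificates from Farkas -/

/-- **CONV data with `p` rows separating cliques from colourings force `(k-1)^m ≤ (#E·C(m,k)+1)^p · …`**,
whatever the psd dimension `q` and the real data. [folklore] -/
theorem pow_le_of_convEdgeData {m k p q : ℕ} (hk : 2 ≤ k) (hkm : k ≤ m)
    (A : Fin p → Matrix (Fin q) (Fin q) ℝ) (b : Fin p → ℝ)
    (B' : Fin p → (⊤ : SimpleGraph (Fin m)).edgeSet → ℝ) (hB' : ∀ i e, 0 ≤ B' i e)
    (hacc : ∀ S : Finset (Fin m), S.card = k → ∃ Y : Matrix (Fin q) (Fin q) ℝ, Y.PosSemidef ∧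
      ∀ i, (A i * Y).trace ≤ b i + ∑ e, B' i e * (if cliqueVec S e then (1 : ℝ) else 0))
    (hrej : ∀ h : Fin m → Fin (k - 1), ¬ ∃ Y : Matrix (Fin q) (Fin q) ℝ, Y.PosSemidef ∧
      ∀ i, (A i * Y).trace ≤ b i + ∑ e, B' i e * (if colorVec h e then (1 : ℝ) else 0)) :
    (k - 1) ^ m ≤
      (Fintype.card ((⊤ : SimpleGraph (Fin m)).edgeSet × {S : Finset (Fin m) // S.card = k}) + 1) ^ p *
        (k ^ 2 * m ^ (k ^ 2) * (k - 1) ^ ((m + k) / 2 + k ^ 2)) := by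
  classical
  -- right-hand sides and the free trace bound
  set rhs : ((⊤ : SimpleGraph (Fin m)).edgeSet → Bool) → Fin p → ℝ :=
    fun x i => b i + ∑ e, B' i e * (if x e then (1 : ℝ) else 0) with hrhs
  obtain ⟨R, hR, hRiff⟩ := conv_exists_traceBound A rhs
  refine pow_le_of_strictCertificates hk hkm B' hB' fun h => ?_
  -- Farkas certificate of the rejected colouring
  have hinf : ¬ ∃ Y : Matrix (Fin q) (Fin q) ℝ, Y.PosSemidef ∧ Y.trace ≤ R ∧
      ∀ i, (A i * Y).trace ≤ rhs (colorVec h) i := fun hY => hrej h ((hRiff _).2 hY)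
  obtain ⟨y, lam, hy, hlam, hpsd, hneg⟩ := certificate_of_infeasible_traceBounded A _ hR hinf
  refine ⟨y, hy, fun S hS => ?_⟩
  -- compare with the accepted clique `S`
  obtain ⟨Y, hYpsd, hYtr, hYrows⟩ := (hRiff (cliqueVec S)).1 (hacc S hS)
  have h1 : 0 ≤ ∑ i, y i * (A i * Y).trace + lam * Y.trace := hpsd Y hYpsd
  have h2 : ∑ i, y i * (A i * Y).trace ≤ ∑ i, y i * rhs (cliqueVec S) i :=
    Finset.sum_le_sum fun i _ => mul_le_mul_of_nonneg_left (hYrows i) (hy i)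
  have h3 : lam * Y.trace ≤ lam * R := mul_le_mul_of_nonneg_left hYtr hlam
  have hlt : ∑ i, y i * rhs (colorVec h) i < ∑ i, y i * rhs (cliqueVec S) i := by linarith
  -- expand both sides: the `y · b` parts cancel
  have hexp : ∀ x : (⊤ : SimpleGraph (Fin m)).edgeSet → Bool, ∑ i, y i * rhs x i =
      ∑ i, y i * b i + ∑ e, if x e = true then (∑ i, y i * B' i e) else 0 := by
    intro x
    rw [hrhs]; dsimp only
    simp only [mul_add, Finset.sum_add_distrib, Finset.mul_sum]
    congr 1
    rw [Finset.sum_comm]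
    refine Finset.sum_congr rfl fun e _ => ?_
    split_ifs with he
    · simp only [mul_one]
    · simp
  rw [hexp, hexp] at hlt
  linarith

/-! ### One gate over `{∧₂, ∨₂} ∪ CONV^{rows ≤ P}` does not compute CLIQUE -/

/-- `∧₂` and `∨₂` are one-row CONV gates (threshold rows, no psd variable). [folklore] -/
theorem and_or_mem_convRows {P : ℕ} (hP : 1 ≤ P) (g : GateFn) (hg : g = GateFn.and 2 ∨ g = GateFn.or 2) :
    ∃ p q : ℕ, p ≤ P ∧ ∃ (A : Fin p → Matrix (Fin q) (Fin q) ℝ) (b : Fin p → ℝ)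
      (B : Fin p → Fin g.1 → ℝ), (∀ i j, 0 ≤ B i j) ∧ ∀ v : Fin g.1 → Bool, g.2 v = true ↔
        ∃ Y : Matrix (Fin q) (Fin q) ℝ, Y.PosSemidef ∧
          ∀ i, (A i * Y).trace ≤ b i + ∑ j, B i j * (if v j then (1 : ℝ) else 0) := by
  have h : IsConvGate 1 g := by
    rcases hg with rfl | rfl
    · exact and_isConvGate 2
    · exact or_isConvGate 2
  obtain ⟨p, q, hpq, A, b, B, hB, hiff⟩ := h
  exact ⟨p, q, by omega, A, b, B, hB, hiff⟩

/-- **One CONV gate with at most `P` rows does not compute CLIQUE**, finite form: if `k ≥ 3`, `1 ≤ P` and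
`(#E·C(m,k) + 1)^P · k² m^{k²} (k-1)^{(m+k)/2+k²} < (k-1)^m`, no circuit with at most one gate over
`{∧₂, ∨₂} ∪ {CONV gates with ≤ P rows, ANY psd dimension and data}` computes `CLIQUE(m,k)`. [folklore] -/
theorem not_computes_cliqueFn_of_convFewRows {m k P : ℕ} (hk : 3 ≤ k) (hkm : k ≤ m) (hP : 1 ≤ P)
    (hnum : (Fintype.card ((⊤ : SimpleGraph (Fin m)).edgeSet × {S : Finset (Fin m) // S.card = k}) + 1) ^ P *
        (k ^ 2 * m ^ (k ^ 2) * (k - 1) ^ ((m + k) / 2 + k ^ 2)) < (k - 1) ^ m)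
    (C : Circuit ((⊤ : SimpleGraph (Fin m)).edgeSet))
    (hC : C.IsOver ({GateFn.and 2, GateFn.or 2} ∪ {g : GateFn | ∃ p q : ℕ, p ≤ P ∧
      ∃ (A : Fin p → Matrix (Fin q) (Fin q) ℝ) (b : Fin p → ℝ) (B : Fin p → Fin g.1 → ℝ),
        (∀ i j, 0 ≤ B i j) ∧ ∀ v : Fin g.1 → Bool, g.2 v = true ↔
          ∃ Y : Matrix (Fin q) (Fin q) ℝ, Y.PosSemidef ∧
            ∀ i, (A i * Y).trace ≤ b i + ∑ j, B i j * (if v j then (1 : ℝ) else 0)}))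
    (hsize : C.size ≤ 1) : ¬ C.Computes (cliqueFn m k) := by
  classical
  intro hcomp
  have hk1 : k - 1 < k := by omega
  have hproj : ∀ e : (⊤ : SimpleGraph (Fin m)).edgeSet, (∀ x, C.eval x = x e) → False := by
    intro e he
    obtain ⟨a, a', hab⟩ := sym2_exists_eq_mk (e : Sym2 (Fin m))
    have hne : a ≠ a' := by
      have hmem := e.2
      rw [hab, SimpleGraph.mem_edgeSet, SimpleGraph.top_adj] at hmem
      exact hmem
    let h : Fin m → Fin (k - 1) := fun v => if v = a then ⟨0, by omega⟩ else ⟨1, by omega⟩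
    have h1 : colorVec h e = true := by
      simp only [colorVec, Bool.not_eq_true', decide_eq_false_iff_not]
      rw [hab, Sym2.map_mk, Sym2.mk_isDiag_iff]
      simp only [h, if_pos rfl, if_neg (Ne.symm hne)]
      exact fun heq => absurd (Fin.mk.inj_iff.1 heq) (by norm_num)
    have h2 := hcomp (colorVec h)
    rw [he, h1, cliqueFn_colorVec h hk1] at h2
    exact Bool.noConfusion h2
  obtain ⟨gates, out, wf, wf_out⟩ := C
  rcases out with e | n
  · exact hproj e fun x => rfl
  · have hn : n < gates.length := wf_out n rfl
    have hlen : gates.length = 1 := by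
      change gates.length ≤ 1 at hsize
      omega
    obtain ⟨g, rfl⟩ := List.length_eq_one_iff.1 hlen
    have hn0 : n = 0 := by simp at hn; omega
    subst hn0
    have hev : ∀ x : (⊤ : SimpleGraph (Fin m)).edgeSet → Bool,
        Circuit.eval ⟨[g], Sum.inr 0, wf, wf_out⟩ x =
          g.op (fun a => Sum.elim x (fun _ => false) (g.args a)) := by
      intro x
      simp only [Circuit.eval, Circuit.wireVals, List.foldl_cons, List.foldl_nil, List.nil_append,
        List.getD_cons_zero]
      congr 1
      funext a
      cases g.args a <;> simp
    have hg : g.fn ∈ {g : GateFn | ∃ p q : ℕ, p ≤ P ∧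
        ∃ (A : Fin p → Matrix (Fin q) (Fin q) ℝ) (b : Fin p → ℝ) (B : Fin p → Fin g.1 → ℝ),
          (∀ i j, 0 ≤ B i j) ∧ ∀ v : Fin g.1 → Bool, g.2 v = true ↔
            ∃ Y : Matrix (Fin q) (Fin q) ℝ, Y.PosSemidef ∧
              ∀ i, (A i * Y).trace ≤ b i + ∑ j, B i j * (if v j then (1 : ℝ) else 0)} := by
      have h1 := hC g (by simp)
      rcases h1 with h1 | h1
      · rcases h1 with h1 | h1
        · exact and_or_mem_convRows hP g.fn (Or.inl h1)
        · exact and_or_mem_convRows hP g.fn (Or.inr (Set.mem_singleton_iff.1 h1))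
      · exact h1
    obtain ⟨p, q, hp, A, b, B, hB, hiff⟩ := hg
    let B' : Fin p → (⊤ : SimpleGraph (Fin m)).edgeSet → ℝ :=
      fun i e => ∑ j ∈ univ.filter (fun j : Fin g.arity => g.args j = Sum.inl e), B i j
    have hB' : ∀ i e, 0 ≤ B' i e := fun i e => Finset.sum_nonneg fun j _ => hB i j
    have hind : ∀ (x : (⊤ : SimpleGraph (Fin m)).edgeSet → Bool) (j : Fin g.arity),
        (if Sum.elim x (fun _ => false) (g.args j) then (1 : ℝ) else 0)
          = ∑ e, if g.args j = Sum.inl e then (if x e then (1 : ℝ) else 0) else 0 := by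
      intro x j
      rcases hja : g.args j with e₀ | n₀
      · simp only [Sum.elim_inl, Sum.inl.injEq]
        rw [Finset.sum_ite_eq]
        simp
      · simp
    have hkey : ∀ (x : (⊤ : SimpleGraph (Fin m)).edgeSet → Bool) (i : Fin p),
        (∑ j, B i j * (if Sum.elim x (fun _ => false) (g.args j) then (1 : ℝ) else 0))
          = ∑ e, B' i e * (if x e then (1 : ℝ) else 0) := by
      intro x i
      simp_rw [hind, Finset.mul_sum, B', Finset.sum_mul]
      rw [Finset.sum_comm]
      refine Finset.sum_congr rfl fun e _ => ?_
      rw [Finset.sum_filter]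
      refine Finset.sum_congr rfl fun j _ => ?_
      split_ifs <;> simp
    have hacc : ∀ S : Finset (Fin m), S.card = k → ∃ Y : Matrix (Fin q) (Fin q) ℝ, Y.PosSemidef ∧
        ∀ i, (A i * Y).trace ≤ b i + ∑ e, B' i e * (if cliqueVec S e then (1 : ℝ) else 0) := by
      intro S hS
      have h1 := hcomp (cliqueVec S)
      rw [hev, cliqueFn_cliqueVec hS.ge] at h1
      obtain ⟨Y, hY, hrows⟩ := (hiff _).1 h1
      exact ⟨Y, hY, fun i => by rw [← hkey]; exact hrows i⟩
    have hrej : ∀ h : Fin m → Fin (k - 1), ¬ ∃ Y : Matrix (Fin q) (Fin q) ℝ, Y.PosSemidef ∧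
        ∀ i, (A i * Y).trace ≤ b i + ∑ e, B' i e * (if colorVec h e then (1 : ℝ) else 0) := by
      intro h hY
      have h1 := hcomp (colorVec h)
      rw [hev, cliqueFn_colorVec h hk1] at h1
      obtain ⟨Y, hY, hrows⟩ := hY
      have h3 := (hiff _).2 ⟨Y, hY, fun i => by rw [hkey]; exact hrows i⟩
      exact Bool.noConfusion (h3.symm.trans h1)
    have hle := pow_le_of_convEdgeData (by omega) hkm A b B' hB' hacc hrej
    have hmono : (Fintype.card ((⊤ : SimpleGraph (Fin m)).edgeSet × {S : Finset (Fin m) // S.card = k})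
        + 1) ^ p ≤ (Fintype.card ((⊤ : SimpleGraph (Fin m)).edgeSet × {S : Finset (Fin m) // S.card = k})
        + 1) ^ P := Nat.pow_le_pow_right (by omega) hp
    have := Nat.mul_le_mul_right (k ^ 2 * m ^ (k ^ 2) * (k - 1) ^ ((m + k) / 2 + k ^ 2)) hmono
    omega

/-! ### Exponent bookkeeping and the corner in the shape of the crux (`δ = 1/4`) -/

/-- `#E(K_m)·C(m,k) + 1 ≤ m^(k+3)` for `m ≥ 2`. [folklore] -/
theorem card_edges_mul_kSets_le {m k : ℕ} (hm : 2 ≤ m) :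
    Fintype.card ((⊤ : SimpleGraph (Fin m)).edgeSet × {S : Finset (Fin m) // S.card = k}) + 1 ≤
      m ^ (k + 3) := by
  rw [Fintype.card_prod]
  have h1 : Fintype.card (⊤ : SimpleGraph (Fin m)).edgeSet ≤ m ^ 2 := CliqueLPGate.nE_le m
  have h2 : Fintype.card {S : Finset (Fin m) // S.card = k} ≤ m ^ k := by
    have : Fintype.card {S : Finset (Fin m) // S.card = k} = m.choose k := CliqueLPGate.nK_eq m k
    rw [this]
    exact Nat.choose_le_pow m k
  have h3 : 1 ≤ m ^ (k + 2) := Nat.one_le_pow _ _ (by omega)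
  calc Fintype.card (⊤ : SimpleGraph (Fin m)).edgeSet * Fintype.card {S : Finset (Fin m) // S.card = k} + 1
      ≤ m ^ 2 * m ^ k + m ^ (k + 2) := Nat.add_le_add (Nat.mul_le_mul h1 h2) h3
    _ = 2 * m ^ (k + 2) := by ring
    _ ≤ m * m ^ (k + 2) := Nat.mul_le_mul_right _ hm
    _ = m ^ (k + 3) := by ring

/-- Pure arithmetic: if `k ≥ 3`, `m ≤ (k-1)^8`, `k² ≤ m` and `16 P (k+3) + 18 k² + k + 16 < m`, then
`(m^(k+3))^P · k² m^{k²} (k-1)^{(m+k)/2 + k²} < (k-1)^m` (everything in powers of `k - 1`). [folklore] -/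
theorem fewRows_numerics {m k P : ℕ} (hk : 3 ≤ k) (h8 : m ≤ (k - 1) ^ 8) (hk2 : k ^ 2 ≤ m)
    (hP : 16 * P * (k + 3) + 18 * k ^ 2 + k + 16 < m) :
    (m ^ (k + 3)) ^ P * (k ^ 2 * m ^ (k ^ 2) * (k - 1) ^ ((m + k) / 2 + k ^ 2)) < (k - 1) ^ m := by
  have hk1 : 2 ≤ k - 1 := by omega
  have hA : (m ^ (k + 3)) ^ P ≤ (k - 1) ^ (8 * (k + 3) * P) := by
    calc (m ^ (k + 3)) ^ P ≤ (((k - 1) ^ 8) ^ (k + 3)) ^ P := by gcongr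
      _ = (k - 1) ^ (8 * (k + 3) * P) := by rw [← pow_mul, ← pow_mul, mul_assoc]
  have hB : k ^ 2 ≤ (k - 1) ^ 8 := hk2.trans h8
  have hC : m ^ (k ^ 2) ≤ (k - 1) ^ (8 * k ^ 2) := by
    calc m ^ (k ^ 2) ≤ ((k - 1) ^ 8) ^ (k ^ 2) := Nat.pow_le_pow_left h8 _
      _ = (k - 1) ^ (8 * k ^ 2) := by rw [← pow_mul]
  have h16 : 16 * P * (k + 3) = 2 * (8 * (k + 3) * P) := by ring
  have hexp : 8 * (k + 3) * P + 8 + 8 * k ^ 2 + ((m + k) / 2 + k ^ 2) < m := by omega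
  calc (m ^ (k + 3)) ^ P * (k ^ 2 * m ^ (k ^ 2) * (k - 1) ^ ((m + k) / 2 + k ^ 2))
      ≤ (k - 1) ^ (8 * (k + 3) * P) * ((k - 1) ^ 8 * (k - 1) ^ (8 * k ^ 2) *
          (k - 1) ^ ((m + k) / 2 + k ^ 2)) := by gcongr
    _ = (k - 1) ^ (8 * (k + 3) * P + 8 + 8 * k ^ 2 + ((m + k) / 2 + k ^ 2)) := by
        simp only [pow_add]; ring
    _ < (k - 1) ^ m := Nat.pow_lt_pow_right (by omega) hexp

open scoped Classical in
/-- **The few-rows corner, in the shape of the crux (`δ = 1/4`, unconditional).** For all large `m` and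
every row budget `P ≥ 1` with `16 P (⌈m^{1/4}⌉₊ + 3) + 18 ⌈m^{1/4}⌉₊² + ⌈m^{1/4}⌉₊ + 16 < m` (so up to
`P ≈ m^{3/4}/16`), no circuit with at most one gate over
`{∧₂, ∨₂} ∪ {CONV gates with ≤ P rows — ANY psd dimension, ANY real data}` computes
`CLIQUE(m, ⌈m^{1/4}⌉₊)` (written inline as in the route file). Together with the crux-#2 provers' corners
(few LP variables, small psd block) this says: a single-gate CONV kill of the crux needs BOTH
`≳ m^{3/4}` rows and a psd block of dimension `≳ m^{3/8}`. [folklore] -/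
theorem cliqueExtLowerBound_convFewRows_corner : ∀ᶠ m : ℕ in atTop, ∀ P : ℕ, 1 ≤ P →
    16 * P * (⌈(m : ℝ) ^ (1 / 4 : ℝ)⌉₊ + 3) + 18 * ⌈(m : ℝ) ^ (1 / 4 : ℝ)⌉₊ ^ 2 +
      ⌈(m : ℝ) ^ (1 / 4 : ℝ)⌉₊ + 16 < m →
    ∀ C : Circuit ((⊤ : SimpleGraph (Fin m)).edgeSet),
      C.IsOver ({GateFn.and 2, GateFn.or 2} ∪ {g : GateFn | ∃ p q : ℕ, p ≤ P ∧
        ∃ (A : Fin p → Matrix (Fin q) (Fin q) ℝ) (b : Fin p → ℝ) (B : Fin p → Fin g.1 → ℝ),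
          (∀ i j, 0 ≤ B i j) ∧ ∀ v : Fin g.1 → Bool, g.2 v = true ↔
            ∃ Y : Matrix (Fin q) (Fin q) ℝ, Y.PosSemidef ∧
              ∀ i, (A i * Y).trace ≤ b i + ∑ j, B i j * (if v j then (1 : ℝ) else 0)}) →
      C.size ≤ 1 →
      ¬ C.Computes (fun x => decide (¬ (SimpleGraph.fromEdgeSet {e : Sym2 (Fin m) |
        ∃ h : e ∈ (⊤ : SimpleGraph (Fin m)).edgeSet, x ⟨e, h⟩ = true}).CliqueFree
          ⌈(m : ℝ) ^ (1 / 4 : ℝ)⌉₊)) := by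
  filter_upwards [eventually_threshold_corner_conditions 0] with m hm P hP hrows C hC hsize
  obtain ⟨h3, h8, hk2, -, hm2⟩ := hm
  set k := ⌈(m : ℝ) ^ (1 / 4 : ℝ)⌉₊ with hk
  have hkm : k ≤ m := le_trans (by nlinarith) hk2
  refine not_computes_cliqueFn_of_convFewRows h3 hkm hP ?_ C hC hsize
  calc (Fintype.card ((⊤ : SimpleGraph (Fin m)).edgeSet × {S : Finset (Fin m) // S.card = k}) + 1) ^ P *
        (k ^ 2 * m ^ (k ^ 2) * (k - 1) ^ ((m + k) / 2 + k ^ 2))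
      ≤ (m ^ (k + 3)) ^ P * (k ^ 2 * m ^ (k ^ 2) * (k - 1) ^ ((m + k) / 2 + k ^ 2)) :=
        Nat.mul_le_mul_right _ (Nat.pow_le_pow_left (card_edges_mul_kSets_le hm2) _)
    _ < (k - 1) ^ m := fewRows_numerics h3 h8 hk2 hrows

end Gen3FewRows

end Summit.PneNP.PneNP.Cruxes.CliqueExtLowerBound.Disproof
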